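import Mathlib
import HarnessLib
import HarnessLib.Audit
import Summits.BirchSwinnertonDyer.Statement
import Literature.NumberTheory.EllipticCurves.PAdicLFunction
import Literature.NumberTheory.EllipticCurves.PAdicHeights
import Literature.NumberTheory.EllipticCurves.CanonicalPAdicHeight
import Literature.NumberTheory.EllipticCurves.Regulator
import Literature.NumberTheory.EllipticCurves.PAdicHeightsLogProofs
import Literature.NumberTheory.EllipticCurves.GlobalMinimalModelProofs
import Literature.NumberTheory.EllipticCurves.MinimalModelReduction
import Literature.NumberTheory.EllipticCurves.VariableChangePoints
import Literature.NumberTheory.DiophantineGeometry.LocalReductionProofs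
import Literature.NumberTheory.DiophantineGeometry.MinimalModelUniquenessProofs
import Literature.NumberTheory.EllipticCurves.Isogeny
import Literature.NumberTheory.EllipticCurves.Selmer
import Literature.NumberTheory.EllipticCurves.PAdicBSD
import Literature.NumberTheory.EllipticCurves.IwasawaSelmer
import Summits.BirchSwinnertonDyer.BirchSwinnertonDyer.Theorems.SqueezeUBOfSelmerCapAtOnePrime
import HarnessLib.Audit.Status.Attr

/-!
Route: LeadingTerm

# Route LeadingTerm — leading-term consistency at the algebraic rank forbids excess vanishing; one
pinch prime (2001 archimedean–tame cluster re-typed)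

RESURRECT-2001 (lens resurrect-2001, cycle 1): the earlier programme's leading-term cluster — routes
summits/bsd/routes/archimedean-tame-consistency (STATUS upheld v7, 5 GREEN Lean files),
reciprocity-law-class-lift (upheld v18, 2 GREEN), equivariant-tamagawa (upheld v10, 5 GREEN),
mazur-tate-finite-layers (upheld v3) and, for the pinch, sha-finiteness-first (upheld v9, 4 GREEN) —
re-typed crux-only into today's Statement. It suffices to show X = LB_∞ ∧ UB: (LB_∞) for every
elliptic E/ℚ the RANK-INDEXED Taylor coefficient L^(r)(E,1), r = rank_ℤ E(ℚ) (the ALGEBRAIC rank),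
is non-zero; (UB) rank_ℤ E(ℚ) ≤ ord_{s=1} L(E,s) (item SqueezeUBR2, shared verbatim with routes
Squeeze / HigherGrossZagier). LB_∞ is produced — without constructing a single point and without any
order-of-vanishing comparison — from two cruxes at ONE good ordinary prime: CONSISTENCY (#2: the
archimedean BSD quotient L^(r)(E,1)/(r!·Ω⁺_f·Reg_∞) and the p-adic one
[T^r]L_p(E,T)·log_p(γ)^r/((1−α⁻¹)²·Reg_p) are ONE rational number q — the 2001 'archimedean–tame
consistency γ_{E,p} = ρ(E)' in its wild shadow, = the p-adic Beilinson formula at the index r_MW)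
and PINCH (#3: some good ordinary p has ord_T L_p(E,T) = rank_ℤ E(ℚ) exactly): at the pinch prime
[T^r]L_p ≠ 0 forces q ≠ 0, hence L^(r)(E,1) ≠ 0, hence r_an ≤ r_MW; UB closes the squeeze. The
Schneider-free TAME form of #2/#3 (Kurihara numbers δ_n and Mazur–Tate tame regulators, 2001
Theorems A–F) is the intended strengthening: its pinch is typed here as the support TamePinchR,
stated for NON-CM curves (rev 6 repair: the ∀W-form TamePinch, stmt-BirchSwinnertonDyer-15532, was
refuted-misstated 2026-08-16 by Theorems.LeadingTermTamePinch_refuted — the CM curve y² = x³ − x has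
no odd prime of surjective mod-p image, so no admissible p; C′ prepends ¬ W.HasCM and the witness
misses it; the thirteen CM j-invariants go to Rubin's CM theory in the tame re-assembly), its
consistency needs the definition requests D1–D2.
Lean: `(∀ (W : WeierstrassCurve ℚ) [W.IsElliptic], iteratedDeriv W.mordellWeilRank W.entireLFunction
1 ≠ 0) ∧ (∀ (W : WeierstrassCurve ℚ) [W.IsElliptic], W.mordellWeilRank ≤ W.analyticRank)`

## Assembly
Bookkeeping + one line of complex analysis, PROVED (planner Sketch.lean, lean check rc 0, 0 sorries,
axioms propext / Classical.choice / Quot.sound; rev 5 = cone repair): `closes (hC : Consistency) (hP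
: PinchPrime) (hUB : SqueezeUBR2) : BirchSwinnertonDyer` (crux-only hypotheses). For elliptic W: UB
gives r_MW ≤ r_an. For LB pass to a global minimal model C•W (hasGlobalMinimalModel_rat_holds), take
the pinch prime p, ITS CANONICAL CYCLOTOMIC HEIGHT DATUM D and the newform f from PinchPrime (rev 5:
D is a witness carried by the crux — it exists at every good ordinary p ≥ 5 by the tree theorem
exists_isCanonical_holds, which is no longer imported), and Reg_∞ > 0, Ω⁺_f > 0, q from Consistency
(rev 5: Ω⁺_f > 0 is Consistency's second well-definedness conjunct — tree theorem
IsNewform0.plusPeriod_pos_holds, no longer imported); order = r_MW gives coeff_(r_MW) L_p ≠ 0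
(PowerSeries.order_eq_nat), log_p γ_cyc ≠ 0 (inline, from padicLog_eq_zero_iff_holds), so q ≠ 0, so
L^(r_MW)(C•W,1) = r!·q·Ω⁺_f·Reg ≠ 0; rank and entire L-function are invariant under C
(VariableChange.finrank_point_variableChange; local Euler factors via minimal models, verbatim the
transport block of PAdicOrderV2's certified closes), so iteratedDeriv r_MW L_W 1 ≠ 0; finally,
junk-robustly: if r_an(W) > r_MW then r_an ≥ 1 forces AnalyticAt and finite order = r_an
(analyticOrderNatAt_of_not_analyticAt, Nat.cast_analyticOrderNatAt), and
natCast_le_analyticOrderAt_iff_iteratedDeriv_eq_zero makes the r_MW-th derivative vanish —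
contradiction; le_antisymm. No modularity, no unproved Literature fact is a hypothesis. Module
import cone after rev 5: 43 files (rev 4: 366), see NOT DECOMPOSED YET / dependency hygiene.

Rationale: WHY THIS LINE. Mechanism (2001 archimedean-tame-consistency Prop.(2), never assembled to RANK
there): classical BSD and Mazur–Tate–Teitelbaum p-adic BSD (MazurTateTeitelbaum1986Invent §II.10;
Delbourgo2008 Conj. 2.3; tree PAdicBSDConjecture) share the same r = rank E(ℚ) and the same
inaccessible constant #Ш·Tam/#tors², so their QUOTIENT at the index r_MW is a Ш-free identity
between two regulators of ONE lattice E(ℚ) — Perrin-Riou's p-adic Beilinson philosophy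
(PerrinRiou1987 Thm 1.3 is its r = 1 case; BKS arXiv:1910.07404 Conj. 1.1 / Cor. 1.10 formulate it
under the hypothesis r_an = r_MW with the leading term L*); indexing it at r_MW WITHOUT assuming
r_an = r_MW turns it into a transfer of non-vanishing from the algebraic side (where Kato + IMC +
Ш/Schneider at one prime control [T^r]L_p) to the complex side (where nothing sees L^(r) for r ≥ 2),
i.e. into r_an ≤ r_MW — the half of BSD-rank that otherwise needs constructed points
(HeegnerPointBarrier). Imported areas: cyclotomic Iwasawa theory / Kato's Euler system (Kato2004 Thm
18.4, SkinnerUrban2014, arXiv:2412.20078), p-adic heights (Schneider1985, MazurSteinTate2006),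
refined BSD of Mazur–Tate type (doi:10.1215/s0012-7094-87-05431-7 Conj. 4; Kurihara numbers
arXiv:2203.12159; BKS arXiv:2103.11535). What no current route does: SelmerRank compares CORANKS,
PAdicOrderV2 compares ORDERS of vanishing (its hard half ord_T L_p ≤ ord_s L is replaced here by UB
at Mordell–Weil level, its ∀p BSD(p)-rank by an ∃p pinch), HigherGrossZagier CONSTRUCTS points,
Squeeze is the accounting frame, ShadowIsolation attacks Ш by level raising — none files a
leading-COEFFICIENT identity; the ledger's only precedent is the closed card
sha-free-ratio-law-upper-bound (ratio law at r_an, for UB, closed known:PAdicOrder), a different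
index, direction and use. What changed from 2001: (i) typed over the tree's wild objects
(padicLFunction, canonical p-adic height; 2001 reciprocity-law Thm C converts wild↔tame under
Schneider), (ii) the 2001 hypotheses 'IMC + Ш[p]=0' become the single ∃p pinch crux, (iii) a
certified deciding theorem to the Clay statement. Negatives index: empty (2026-08-16).

RANKED CRUXES. #2 Consistency (crux) — LEADING-TERM CONSISTENCY at the algebraic rank (wild shadow
of the 2001 archimedean–tame consistency γ_(E,p) = ρ(E)): for every elliptic E/ℚ (globally minimal
W), every good ordinary p ≥ 5, the canonical cyclotomic p-adic height datum D and the newform f of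
E, with r := rank_ℤ E(ℚ): the archimedean BSD quotient is well defined — Reg_∞(E) > 0 (Néron–Tate;
tree theorem regulator_pos_holds) and Ω⁺_f > 0 (conjugation-stable period lattice,
CremonaAlgorithms1997 §2.8; tree theorem IsNewform0.plusPeriod_pos_holds; both folded in as
conjuncts — rev 1 / rev 5 — so that the deciding theorem imports neither RegulatorProofs nor the
modular-curve genus files) — and there is q ∈ ℚ with L^(r)(E,1) = r!·q·Ω⁺_f·Reg_∞(E) AND
[T^r]L_p(f,α_p,T)·log_p(γ_cyc)^r = q·(1−α_p⁻¹)²·Reg_p(E,D) (both sides may vanish; at r = 0 this is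
the Mazur–Swinnerton-Dyer interpolation, at r = 1 = r_an Perrin-Riou's p-adic Gross–Zagier).
[difficulty: open-problem] (why it might fail: At r_MW=2 it is the rank-2 p-adic Beilinson formula:
needs an arithmetic avatar of L''(E,1) (none over ℚ); false at one (E,p) whose ∞- and p-adic BSD
quotients differ, and for any E with r_an>r_MW, Ш[p^∞] finite and Reg_p≠0 at some p.)
[MazurTateTeitelbaum1986Invent, PerrinRiou1987, arXiv:1910.07404, arXiv:2103.11535, Delbourgo2008,
MazurSteinTate2006, SteinWuthrich2013, SilvermanAEC2009,
docs/m5/inspiration/BirchSwinnertonDyer/BirchSwinnertonDyer/bsd-archimedean-tame-consistency.md]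
#3 PinchPrime (crux) — ONE PINCH PRIME PER CURVE (2001 sha-finiteness-first 'pinch', ∃-form of
PAdicOrderV2#3): every elliptic E/ℚ (globally minimal W) has a good ordinary prime p ≥ 5 — carried
together with its canonical cyclotomic p-adic height datum D (rev 5: a witness of the crux; it
exists at every good ordinary p ≥ 5 by the tree theorem exists_isCanonical_holds, Schneider /
Mazur–Tate σ-height, so the ∃D clause costs a prover one line and keeps CanonicalPAdicHeightHolds
out of the route's imports) — with ord_(T=0) L_p(f,α_p,T) = rank_ℤ E(ℚ) for the newform f of E (by
Kato ord_T L_p ≥ rank always; equality ⟺ IMC-exactness ∧ #Ш(E)[p^∞] < ∞ ∧ Schneider non-degeneracy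
at that ONE p). [difficulty: open-problem] (why it might fail: Fails iff some E has, at EVERY good
ordinary p≥5, divisible Ш[p^∞] or a degenerate cyclotomic height (or IMC inexact at small image);
certified only curve by curve (elliptic-Wieferich obstruction to any 'infinitely many p' theorem,
2001 sha-finiteness-first §'Why not infinitely many p').) [Schneider1985, Kato2004,
SkinnerUrban2014, arXiv:2412.20078, SteinWuthrich2013, MazurSteinTate2006,
docs/m5/inspiration/BirchSwinnertonDyer/BirchSwinnertonDyer/bsd-sha-finiteness-first.md]
#4 SqueezeUBR2 (crux) — NO EXCESS RANK (UB), shared verbatim with route Squeeze (and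
HigherGrossZagier): rank_ℤ E(ℚ) ≤ ord_(s=1) L(E,s) for every elliptic E/ℚ; known for r_an ≤ 1
(Kolyvagin1990, Kato2004 Thm 14.2), Selmer-level only beyond. [difficulty: open-problem] (why it
might fail: One excess-rank curve (k exhibited independent points and a certified L^(m)(E,1) ≠ 0, m
< k) refutes it and BSD; for r_an ≥ 2 only rank ≤ corank Sel ≤ ord_T L_p is known (Kato 18.4), the
step to ord_s L is open.) [Kolyvagin1990, Kato2004, SkinnerUrban2014,
Literature.Barriers.BirchSwinnertonDyer.SelmerRankBarrier]
#5 KatoDivisibility (crux; a THEOREM in print, XL formalisation) — KATO'S DIVISIBILITY, Astérisque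
295 (2004) Thm 17.4 (1)–(2) for E/ℚ at every odd good ordinary p: X(E/ℚ_∞) is Λ-torsion and char_Λ X
∣ p^n·L_p(f,α_p,T) in Λ⊗ℚ_p (route-choice rchoice-7f99c112, rev 9: the XL-apex Literature fact
kato_divisibility promoted in the form consumed by #2's line — the locus split and stub S1b — and
implying the two support Kato bounds KatoCorankBound (Thm 18.4, corank form, stmt-18048) and
PAdicOrderKatoSideR2 (rank form, stmt-0491) by proved tree theorems). It is a SECOND-LAYER input of
#2, not of the deciding theorem: `closes` keeps the crux-only hypotheses Consistency, PinchPrime,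
SqueezeUBR2 (Kato as a fourth hypothesis would be decoration — PinchPrime's ord_T L_p = rank already
contains Kato's inequality), and #5 feeds the closes hypothesis Consistency through the glue item
ConsistencyOfKato below (route-repair unused-crux, rev 10). [difficulty: XL formalisation] (why it
might fail: only as typed — a γ↔T / normalisation slip; the mathematics is Kato's theorem, p = 2
excluded.) [Kato2004Asterisque Thm 17.4 (p. 273) and Thm 18.4 (p. 281), Rubin2000 Thms 2.3.2–2.3.4,
GreenbergLNM1716 §3 Lemma 3.1, Literature.NumberTheory.EllipticCurves.kato_divisibility]
#9 RankLeOne (support) — the KNOWN slice of Consistency (literature leaf, not in the deciding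
theorem): rank_ℤ E(ℚ) ≤ 1 and r_an = r_MW ⇒ Consistency at (E,p), Reg_∞ > 0 and Ω⁺_f > 0 included —
r = 0 is the interpolation L_p(E,0) = (1−α⁻¹)² L(E,1)/Ω⁺_f (Mazur–Swinnerton-Dyer), r = 1 is
Perrin-Riou's p-adic Gross–Zagier (both sides are heights of the same Heegner point; Gross–Zagier +
Kolyvagin + a non-vanishing twist); adapt
reserve/prior-2001/Prior/BirchSwinnertonDyer/BirchSwinnertonDyer/Bsd_ArchimedeanTameConsistency_MTKurihara.lean
for the bookkeeping. [difficulty: XL] [PerrinRiou1987, GrossZagier1986, Kolyvagin1990,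
MazurTateTeitelbaum1986Invent, Kobayashi2013]
#9 TamePinchR (support; conjecture-grade, gate auto-crux) — the SCHNEIDER-FREE pinch of the intended
tame form for NON-CM curves (2001 archimedean-tame-consistency Thm A / Kurihara–Kim). REV 6 REPAIR
of TamePinch (stmt-BirchSwinnertonDyer-15532, refuted-misstated 2026-08-16 by
Summit.BirchSwinnertonDyer.BirchSwinnertonDyer.Theorems.LeadingTermTamePinch_refuted: the ∀W binder
ranged over the thirteen CM j-invariants, and a CM curve over ℚ has no odd prime of surjective mod-p
image — Serre1972 §4.5, Zywina2015 Prop. 1.14/1.16, tree fact zywina2015_cm_modEll_not_surjective;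
witness W = [0,0,0,−1,0] = 32a2, CM by ℤ[i]; C′ = the refuter's repaired statement, `¬ W.HasCM →`
prepended to the body verbatim, the witness misses it): every NON-CM elliptic E/ℚ (globally minimal
W) has an admissible p (good ordinary ≥ 5, ρ̄ surjective — infinitely many by Serre's open image
theorem and density-one ordinary primes) and a square-free product n of r = rank_ℤ E(ℚ) Kolyvagin
primes ℓ (ℓ ∤ Np, ℓ ≡ 1, a_ℓ ≡ ℓ + 1 ≡ 2 mod p: Kim's 𝒫₁, arXiv:2203.12159 §2, p. 12) whose Kurihara
number δ_n = Σ_(a∈(ℤ/n)^×) [a/n]⁺_f · Π_ℓ ψ_ℓ(a) (Kim §1.4) is non-zero mod p for some surjective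
discrete logs ψ_ℓ : (ℤ/ℓ)^× → ℤ/p; by Kim (arXiv:2203.12159 Thm 1.11: p ≥ 5, ρ̄ surjective, Manin
constant and Tamagawa numbers prime to p, E(ℚ_p)[p] = 0; IMC a theorem there by Kato2004 +
SkinnerUrban2014 + Wan) a non-zero δ_n with ν(n) = rank exists ⟺ Ш(E)[p] = 0 at that p — so
TamePinchR ⟺ every non-CM E/ℚ has ONE admissible p with Kim's side conditions and Ш(E)[p] = 0: KNOWN
for r_an ≤ 1 (Kolyvagin finiteness of Ш + Serre), OPEN for r_an ≥ 2. With the informal crux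
TameConsistency (definition requests D1–D2) and a separate CM item (Rubin1991: main conjecture /
Ш-control for CM curves) it replaces PinchPrime and removes Schneider's conjecture from the line.
Typing note: `(ratPlusSymbol f (a/n) : ZMod p)` is the ℚ → ZMod p cast (junk 0 when p ∣
denominator); Kim's [a/n]⁺ (Néron period) differs from the Ω⁺_f-normalised ratPlusSymbol by a fixed
rational, a p-unit away from finitely many p — harmless in the ∃p form. Rev 6 adds `import
Literature.NumberTheory.EllipticCurves.Isogeny` for `WeierstrassCurve.HasCM` only (see DEPENDENCY
HYGIENE). [difficulty: open-problem] [arXiv:2203.12159, Kurihara2014, MazurTate1987,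
arXiv:2103.11535, Kato2004, SkinnerUrban2014, Serre1972, Zywina2015, Rubin1991,
docs/m5/inspiration/BirchSwinnertonDyer/BirchSwinnertonDyer/bsd-archimedean-tame-consistency.md,
docs/m5/inspiration/BirchSwinnertonDyer/BirchSwinnertonDyer/bsd-reciprocity-law-class-lift.md]
#9 LBOfCruxes (support) — GLUE cruxes → LB_∞ (provable now; it is the first half of the deciding
theorem): Consistency → PinchPrime → for every elliptic W, iteratedDeriv (rank W) L_W 1 ≠ 0 (pass to
a global minimal model; pinch prime, canonical height datum D and newform f from PinchPrime;
[T^r]L_p ≠ 0 by PowerSeries.order_eq_nat, log_p γ ≠ 0 (padicLog_eq_zero_iff_holds), hence q ≠ 0;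
Ω⁺_f > 0 and Reg_∞ > 0 from Consistency make the archimedean side ≠ 0; transport back by isomorphism
invariance of rank and L-function). [difficulty: provable-now] [MazurTateTeitelbaum1986Invent,
SilvermanAEC2009]

#9 ConsistencyOfKato (support; glue, route-repair unused-crux rev 10) — KatoDivisibility →
SqueezeUBR2 → RankLeOne → Consistency: the CONDITIONAL FORM of #2 that its line `Sketch` delivers
(lead composition consistency_of_stubs (hUB : SqueezeUBR2) (hR1 : RankLeOne) (hK :
PAdicOrderKatoSideR2) : Consistency over the registered stubs S1a/S1b/S2, bookkeeping landed as
Theorems/LeadingTermConsistencyCells; Kato enters S1b in corank form and the locus split in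
divisibility form, and KatoDivisibility → KatoCorankBound → PAdicOrderKatoSideR2 holds by proved
tree theorems). Through it the Kato crux #5 feeds the closes hypothesis Consistency (hierarchical
cone: premises KatoDivisibility, SqueezeUBR2, RankLeOne; head Consistency). Implied by Consistency
trivially (planner Sketch.lean rc 0); closes together with #2's stubs; not separately staffed.
[difficulty: = #2's open stubs (S2 = the rank-≥2 p-adic Beilinson formula)] [Kato2004Asterisque,
MazurTateTeitelbaum1986Invent, arXiv:1910.07404]
TWO-LAYER PLAN. Foreseen, not filed: (a) TAME RE-ASSEMBLY once D1–D2 land: Consistency ⇐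
TameConsistency (δ_n ≡ (−1)^r·q_E·t_n·D_n(ψ)² mod p^k at generic depth-r_MW Kolyvagin levels, q_E =
L^(r)(E,1)/(r!·Ω_E·Reg_∞)) → WildTameBridge (2001 reciprocity-law Thm A+C: C_(E,p)·Reg_p =
ε^r(1−α⁻¹)^(−2)[T^r]L_p; adapt reserve/prior-2001/…/Bsd_ReciprocityLawClassLift_RlclMTCore.lean) →
Consistency, and PinchPrime replaced by TamePinchR (non-CM) + a CM item (Rubin1991) + Chebotarev
supply of unit tame regulators (2001 Thm A(b)); (b) Consistency ⇐ ConsistencyRankTwo (r_MW = 2: the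
first open case, the rank-2 p-adic Beilinson formula) → ConsistencyHigher → Consistency; (c)
PinchPrime ⇐ ShaPFiniteSomewhere (∃ good ordinary p, #Ш[p^∞] < ∞) → SchneiderSomewhere (Reg_p ≠ 0 at
that p) → PinchPrime via IMC (SkinnerUrban2014 / arXiv:2412.20078) and Perrin-Riou–Schneider (tree
IwasawaLeadingTerm.order_eq_iff). k ≤ 3 each, depth 1.

KILL CRITERIA. SqueezeUBR2 refuted (a certified excess-rank curve) kills this route, Squeeze,
HigherGrossZagier and BSD itself: close refuted:SqueezeUBR2. Consistency refuted at a specific (E,p)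
with r_an = r_MW ≤ 3 certified (Stein–Wuthrich-type exact data: [T^r]L_p by overconvergent modular
symbols, Reg_p by Mazur–Stein–Tate, Reg_∞, L^(r)(E,1) ball) — if the mismatch survives the
normalisation audit (Ω⁺_f vs Ω_E, log_p(γ) vs T-variable, the (c,d)/Manin ambiguity: class misstated
→ file ConsistencyR with the corrected constant) the lever is dead: close refuted:Consistency, bank
the witness as a barrier 'p-adic and archimedean BSD quotients differ'. PinchPrime can die only by
theory (an E with divisible Ш[p^∞] or degenerate height at every good ordinary p): pivot to
TamePinchR (Ш[p] = 0 at one admissible p, Schneider-free; non-CM, CM by Rubin1991) with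
TameConsistency, else close. TamePinchR itself dies only by theory (a non-CM E with Ш[p] ≠ 0 at
EVERY admissible p) or by a second typing witness — then restate again or drop it (it is not a
hypothesis of closes). Mooted (superseded) if PAdicOrderV2 closes PAdicOrderComparisonR2 ∧
PAdicOrderPadicBSDrankR2, or if BSD closes via SelmerRank/HigherGrossZagier.

NOT DECOMPOSED YET. The tame objects (Kurihara numbers as a named def, the Mazur–Tate tame height /
Tate–Lichtenbaum pairings at Kolyvagin primes, Kolyvagin-prime predicate) — definition requests
D1–D3 below; until they land TameConsistency stays informal and the typed line runs through the wild
shadow. The rank-by-rank split of Consistency (r_MW = 2 first) and the IMC / Ш / Schneider legs of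
PinchPrime (Two-layer plan (b),(c)) — glued splits for tenure. Supersingular p (± L-functions,
Kobayashi2013) and split multiplicative p (𝓛-invariant, ExceptionalZeroBarrier) variants of both
cruxes — not needed (the thesis is ∃ one good ORDINARY prime, which every E/ℚ has:
exists_good_ordinary_prime_holds). CM curves need no separate treatment in the wild form (no
big-image hypothesis in #2/#3); the tame pinch is stated for ¬ W.HasCM only (TamePinchR; the ∀W form
TamePinch was refuted-misstated on the CM curve 32a2, 2026-08-16, and stays in the ledger as
negative knowledge) — the tame re-assembly needs a separate CM item (Rubin1991). DEPENDENCY HYGIENE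
/ CONE (rev 5, route-repair planner 2026-08-16, priority guardrail blocked-by-cone: 43 unproved
named facts in the 366-file MODULE cone of rev 4, while the used-constants cone of items + closes
was already clean — 93 constants, 0 unproved). Rev 5 keeps exactly the imports the 8 decls + closes
elaborate against (planner Sketch.lean rc 0): PAdicLFunction, PAdicHeights, CanonicalPAdicHeight,
Regulator, PAdicHeightsLogProofs, GlobalMinimalModelProofs, MinimalModelReduction,
VariableChangePoints, DiophantineGeometry.LocalReductionProofs,
DiophantineGeometry.MinimalModelUniquenessProofs (module cone 43 files). DROPPED:
CanonicalPAdicHeightHolds (rode in only for exists_isCanonical_holds in closes; its proof chain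
PadicSigmaExistenceProofs → … → FormalInvariantDerivation → PowerSeriesRegularLocal →
AlgebraicGeometry/Resolution/* carried ResolutionOfSingularities,
CossartPiltant2019(+LU3/Patching/…), Temkin2013, CossartJannsenSaito2020, and
CanonicalPAdicHeightOfSigmaExistenceProofs → CanonicalPAdicHeightKProofs →
PadicPointsFiniteIndexProofs → BhargavaShankarEq31Proofs → … carried BSDSelmer (p_parity,
selmerCorank_mod_two_eq, average_card_selmerTwo, …), BSDWave0 (tunnell_even/odd,
pos_proportion_rank_zero, …), BhargavaShankarCounting/LocalMasses, HasseWeilAbelian,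
GaloisRepresentations/ArtinConductor + HeckeCharacter, Automorphic/AdelicGroupData +
QuaternionAlgebraAdelic + GLnCuspidalSpectrum, LFunctions/DedekindZeta (ERH) — 303 files, none of
them about this line) and ModularFormsGamma0Genus (rode in only for IsNewform0.plusPeriod_pos_holds
in closes; its chain PAdicLFunctionDistributionProofs → PAdicLFunctionProofs /
CuspFormLFunctionProofs / ModularFormsGamma0Rank carried RootNumber
(rootNumber_eq_algebraicRootNumber, nonempty_completedLContinuations), ModularCurve
(nonempty_modularParametrizationData, Manin constant), DedekindZeta — 40 files). The two discharged
tree theorems become one-line obligations of the crux provers instead: PinchPrime carries the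
canonical datum D as a witness (exists_isCanonical_holds), Consistency carries Ω⁺_f > 0 as a
conjunct (IsNewform0.plusPeriod_pos_holds) — both PROVED in tree, so neither crux got harder. What
remains unproved in the rev-5 module cone (4 census entries, = route PAdicOrderV2's 3 + one
definition): needs-fact: Literature.NumberTheory.EllipticCurves.ModularForms.exists_isNewformOf —
GENUINELY NEEDED (Modularity, BCDT2001 Thm A / DiamondShurman2005 Thm 8.8.3): L_p is the p-adic
L-function OF THE NEWFORM f of E, both lead cruxes quantify over `IsNewformOf W f` and PinchPrime
asserts ∃f; it enters through PAdicLFunction → CuspFormLFunction (the file defining IsNewformOf, the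
input type of padicLFunction), so no typing of this line avoids it — tier-0 debt, one seat clears
three entries; rides-along (no seat):
Literature.NumberTheory.EllipticCurves.ModularForms.existsUnique_isNewformOf — same file, ↔
exists_isNewformOf by the PROVED existsUnique_isNewformOf_iff (q-expansion principle);
statement-borne (every BSD route alike, not a hypothesis of any item or of closes, which is
junk-robust): WeierstrassCurve.hasEntireLFunction_rat — AnalyticRank.lean is imported by
Summits/BirchSwinnertonDyer/BirchSwinnertonDyer/Statement.lean itself; reduced in tree to
exists_isNewformOf (hasEntireLFunction_rat_of_exists_isNewformOf, AnalyticRankModularityProofs);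
census artefact (nothing to prove): WeierstrassCurve.HasSplitMultiplicativeReductionAtPrime
(PAdicHeights.lean) is a DEFINITION — the predicate `((W.baseChange ℚ_[p]).minimal
ℤ_[p]).HasSplitMultiplicativeReduction ℤ_[p]` whose binders (W) (p) are section variables, companion
of HasGoodReductionAtPrime / HasMultiplicativeReductionAtPrime — counted as an unproved size-S fact
only because its `def … : Prop :=` line shows no binder; PAdicHeights.lean must stay (it defines
PAdicHeightData, padicRegulator, padicLog, the objects Consistency is about); operator: whitelist it
in the census. Nothing else unproved remains in the cone. REV 6 (route-repair 2026-08-16, TamePinch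
refuted-misstated → TamePinchR): one import added, Literature.NumberTheory.EllipticCurves.Isogeny
(defines the PREDICATE WeierstrassCurve.HasCM used by C′; its imports GaloisAction /
GlobalMinimalModel / MordellWeil were already in the cone: module cone 43 → 44 files);
Isogeny.lean's facts lacking an unconditional _holds (Isogeny.exists_dual, Isogeny.nonempty_symm,
IsIsogenous.symm, isIsogenous_iff_frobeniusTrace_eq) enter the MODULE cone only — the used-constants
cone of items + closes stays at 0 unproved (planner probe of the rev-6 file: #h21_route_deps 97
constants, none unproved; #h21_ground no flags; #h21_check_closes OK — closes unchanged).
Import-free fallback if a cone guardrail objects: hypothesis `{p : ℕ | p.Prime ∧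
W.HasSurjectiveModNGaloisRep p}.Infinite →` (⟺ ¬ W.HasCM over ℚ by Serre1972 + Zywina2015).

KATO CHAIN (rev 10, route-repair unused-crux): the provable-now links KatoDivisibility →
KatoCorankBound (Greenberg Lemma 3.1 selmerCorank_le_coinvariantsRank +
coinvariantsRank_le_order_of_mem_charIdeal + ord g ≤ ord ι g = ord p^n·L_p; rchoice-7f99c112 Sketch
(B)) and KatoCorankBound → PAdicOrderKatoSideR2 (Kummer, selmerCorank_eq_mordellWeilRank_add_holds;
RewiringS1b.lean (ii) on stmt-18048) are sketched in item evidence and may be filed as support glue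
when a slot is free (12 of 15 items after rev 10); they are not needed for the cone —
ConsistencyOfKato takes KatoDivisibility itself as premise.
CHEAPEST FALSIFIER. 389a1 (r_an = r_MW = 2 certified: w = +1, L(E,1) = 0 exactly, L''(E,1) = 1.518…
≠ 0 ball) at p = 5, 7: Consistency predicts [T²]L_p·log_p(γ)²/((1−α⁻¹)²·Reg_p) =
L''(E,1)/(2·Ω⁺_f·Reg_∞) = (#Ш_an·Tam/#tors²)·(Ω_E/Ω⁺_f) as ONE rational; every ingredient is in
print (MazurSteinTate2006 §4: Reg_5, Reg_7 of 389a; SteinWuthrich2013 §§8–10: p-adic BSD verified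
for 389a at all good ordinary p < 100 ASSUMING the analytic Ш = 1 — which is exactly the quotient
identity); the 2001 archimedean-tame-consistency paper reports δ_n = ρ·R_n exactly in 869 instances
on 55 curves of ranks 1–3 (tame form). Not re-run here: no in-tree evaluator for L_p or p-adic
heights (lookup only; consistent).

NUMBERS. r_MW-indexed known cases: r = 0 (interpolation, all good ordinary p), r = 1 = r_an
(Perrin-Riou 1987; Kobayashi2013 supersingular); first open index r_MW = 2. Pinch certificates in
print/2001: 389a1 at every good ordinary 5 ≤ p < 60000 incl. the irregular pair (389a1, 16231) (v_p
Reg_p = 3), 5077a1 p < 40000, 234446a1 (rank 4) 5 ≤ p ≤ 29989 (2001 sha-finiteness-first Thms C–E);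
ord_T L_p = rank for ranks 4–6 at listed primes (2001 padic-overdivisible-coefficient Thm B).

DEFINITION REQUESTS. D1 `kuriharaNumber f p n ψ : ZMod p` (Σ_(a∈(ℤ/n)^×) ratPlusSymbol f (a/n) ·
Π_(ℓ|n) ψ_ℓ(a); Kurihara, Kim arXiv:2203.12159 §1) — inlined in TamePinchR today, wanted as a named
def shared with cards kurihara-sharp-prime-kills-sha-v2 / tame-order-single-prime-ota (topic
Literature/NumberTheory/EllipticCurves). D2 `mazurTateTamePairing W p ℓ : E(ℚ) → E(ℚ) → ZMod p`
(Mazur–Tate 1987 Ch. II tame canonical height at a Kolyvagin prime = Tate–Lichtenbaum pairing on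
Ẽ(𝔽_ℓ)⊗ℤ/p, 2001 arch-tame Thm F; BKS arXiv:2103.11535 §2.2) and the tame regulator `tameRegulator W
p n ψ (P : Fin r → E(ℚ))`. D3 `IsKolyvaginPrime W p k ℓ : Prop` (ℓ ∤ Np, ℓ ≡ 1 mod p^k, a_ℓ ≡ ℓ+1
mod p^k, E(𝔽_ℓ)[p] cyclic). Informal crux to be filed after open: TameConsistency (rank 2 of the
tame form): for admissible p and every generic depth-r_MW level n, δ_n ≡ (−1)^r·q_E·t_n·D_n(ψ)² (mod
p^k) with q_E := L^(r)(E,1)/(r!·Ω_E·Reg_∞) ∈ ℤ_(p) (2001 Thm A(b)/F; Mazur–Tate Conj. 4 with the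
archimedean constant).

Novelty: Searches (2026-08-16, opening planner): lit vsearch "comparison of the p-adic and archimedean BSD
leading terms implies ord ≤ rank" (4 paper hits: MST2006 p-adic heights; Dokchitser BSD quotients
mod squares; trivial zeros; H10 — none states the implication); lit vsearch "generalized Perrin-Riou
conjecture Bockstein regulator Kato zeta element leading term" (book hits only); lit galaxy search
"Mazur-Tate refined conjecture leading term regulator Kurihara" --star all (0), "p-adic Beilinson
formula" --star all (2: LMS 414 vol.; Darmon–Rotger diagonal cycles I), "Generalized Perrin-Riou
Conjecture" --star pdf (0); lit read arXiv:1910.07404 and arXiv:2103.11535 (BKS I/II); ledger: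
routes SelmerRank / PAdicOrderV2 / HigherGrossZagier / Squeeze / ShadowIsolation read; closed card
sha-free-ratio-law-upper-bound; 38 prior-programme notes. Searches (2026-08-17, judge-repair rev
12): lit read arXiv:1910.07404 pp. 3–6 (Conj. 1.1 / 1.5 GPR, Rem. 1.7, Thm 1.8 Generalized Rubin
Formula, Cor. 1.10 p-adic Beilinson, Cor. 1.11, Thm 1.13 — page refs above); lit read
arXiv:1809.09066 pp. 1–3 (Castella–Hsieh: first cases of Darmon–Rotger's non-vanishing conjecture
for generalized Kato classes in rank 2 — the rank-2 analogue of 'y_K non-torsion', Selmer-side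
only); the crux record of the banked parent read end to end (Cruxes/Consistency/NOTES.md, PICKED.md,
STRATEGY-CENSUS.md §§Transfer/Strengthen/Decomposition/Negation, Ideas/*, Lines/Sketch.lean +
birth.lean/.md, Theorems/LeadingTermConsistency  [refs: 1910.07404, 2103.11535, 1809.09066, Skinner2020]

Barriers (technique_class: p-adic-l-functions, kato-euler-system, p-converse): - technique_class: p-adic-l-functions, kato-euler-system, p-converse
- Literature.Barriers.BirchSwinnertonDyer.SelmerRankBarrier: APPLIES and is NOT evaded on the live
cone — #2's Selmer line (glue DeficientVanishingOfKatoSelmer) needs the Selmer-level lower bound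
ord_s L ≤ corank_p Sel from r_an = 4 on, i.e. converses in corank ≥ 2, exactly the class the barrier
says has no engine (corank ≤ 1 only); #4 SqueezeUBR2 is the bare Mordell–Weil UB, open for r_an ≥ 2
as the barrier says; #3 PinchPrime supplies the barrier's right-hand side (Ш[p^∞] cotorsion, indeed
finite, at ONE prime) by hypothesis, curve by curve. The bet: a corank-2 converse from a non-Heegner
Euler system (diagonal cycles / generalized Kato classes, arXiv:1809.09066; bipartite systems) or a
p-adic-analytic route to 'ord_T L_p = 2 ⇒ L''(E,1) ≠ 0'.
- Literature.Barriers.BirchSwinnertonDyer.SelmerRankBarrierNarrow: as the main entry.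
- Literature.Barriers.BirchSwinnertonDyer.HeegnerPointBarrier: HONEST (rev 12) — no point is
constructed by the deciding theorem, but every PROVED cell of #2 beyond interpolation/parity ((1,
odd): Perrin-Riou's p-adic Gross–Zagier) and every corank converse feeding its Selmer line
(Skinner2020, BCS2025, CGLS) runs through the Heegner point y_K, which is torsion once r_an ≥ 2
(heegnerPoint_isOfFinAddOrder_of_two_le_analyticRank): the barrier BITES #2's open residue (2,4); it
is not evaded, it is where the crux is open.
- Literature.Barriers.BirchSwinnertonDyer.HeegnerPointBarrierNarro

History (route lifecycle, newest last):
- 2026-08-16T15:52:50Z · rev 4: dropped stmt-BirchSwinnertonDyer-15680, stmt-BirchSwinnertonDyer-15694 — drop the two informal TameConsistency rows (stmt-15680 and its accidental duplicate stmt-15694: the add was re-run to capture the id, and both carry a drafting (planner-plan-lens-BirchSwinnertonDyer-resurrect2001-v2-0)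
- 2026-08-16T16:28:09Z · rev 5: restated Consistency (stmt-BirchSwinnertonDyer-15621), PinchPrime (stmt-BirchSwinnertonDyer-15529), RankLeOne (stmt-BirchSwinnertonDyer-15622) — rev 5 cone repair (rrepair, repair_kind=cone; priority guardrail blocked-by-cone: 43 unproved named facts in the 366-file module cone): drop imports CanonicalPA (planner-rrepair-BirchSwinnertonDyer-LeadingTer-b30d6199-0)
- 2026-08-16T21:39:26Z · BROKEN — TamePinch (stmt-BirchSwinnertonDyer-15532, crux) refuted by Summit.BirchSwinnertonDyer.BirchSwinnertonDyer.Theorems.LeadingTermTamePinch_refuted @ d81663062cca (refuter-rattack-stmt-BirchSwinnertonDyer-15532-0)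
- 2026-08-16T21:55:45Z · rev 6: restated TamePinch (stmt-BirchSwinnertonDyer-15532 refuted) — repair (route-repair rfix b30d6199, rev 6): TamePinch (stmt-BirchSwinnertonDyer-15532, support auto-cruxed, rank 9, NOT a hypothesis of closes) refuted-MISSTATE (planner-rfix-BirchSwinnertonDyer-LeadingTerm-b30d6199-0)
- 2026-08-16T21:55:45Z · REPAIRED (restate TamePinch) — back to open: repair (route-repair rfix b30d6199, rev 6): TamePinch (stmt-BirchSwinnertonDyer-15532, support auto-cruxed, rank 9, NOT a hypothesis of closes) refuted-MISSTATE (planner-rfix-BirchSwinnertonDyer-LeadingTerm-b30d6199-0)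
- 2026-08-26T16:11:34Z · DORMANT — reconciler: no traction for 6.2 d (last activity item-evidence-added at 2026-08-20T10:52:23Z); parked, not closed — `ledger route dormant route-BirchSwinnertonD (operator:999:4058094)
- 2026-08-27T22:26:56Z · REACTIVATED — reconciler: reactivated — activity statement-attached at 2026-08-27T20:45:41Z after parking at 2026-08-26T16:11:34Z (operator:999:1849672)
- 2026-08-28T19:55:28Z · rev 13: informal re-worded for ConsistencySplitGlue (planner-cstrat-stmt-BirchSwinnertonDyer-16217-r1-0)

sub-problem: BirchSwinnertonDyer · status: open · opened planner-plan-lens-BirchSwinnertonDyer-resurrect2001-v2-0 2026-08-16T15:44:03Z · rev 14 · ledger route-BirchSwinnertonDyer-LeadingTerm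
GENERATED by the gate from the ledger (D-0016/17). Provers cite these decls: `theorem foo : Summit.BirchSwinnertonDyer.BirchSwinnertonDyer.Theses.LeadingTerm.<Decl> := …` in Summits/BirchSwinnertonDyer/BirchSwinnertonDyer/Theorems/<Name>.lean.
-/

namespace Summit.BirchSwinnertonDyer.BirchSwinnertonDyer.Theses.LeadingTerm

open scoped BigOperators Topology Manifold Classical MeasureTheory ProbabilityTheory Matrix InnerProductSpace ComplexConjugate ContinuousMap
open Filter Set Function TopologicalSpace MeasureTheory

attribute [summit_statement] _root_.BirchSwinnertonDyer

open Literature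

/-! Retired items kept as plain definitions (history; not obligations of this route): landed proofs / closed glue still name them. -/

/-- retired stmt-BirchSwinnertonDyer-15532 (replaced, gen None) — refuted by Summit.BirchSwinnertonDyer.BirchSwinnertonDyer.Theorems.LeadingTermTamePinch_refuted @ d92bb8bdeddd. -/
def TamePinch : Prop :=
  ∀ (W : WeierstrassCurve ℚ) [W.IsElliptic] [W.IsGloballyMinimal], ∃ (p : ℕ) (_ : Fact p.Prime), 5 ≤ p ∧ Literature.NumberTheory.EllipticCurves.IsOrdinaryAt W p ∧ W.HasSurjectiveModNGaloisRep (p : ℤ) ∧ ∃ (N : ℕ) (_ : NeZero N) (f : CuspForm (CongruenceSubgroup.Gamma0 N) 2), Literature.NumberTheory.EllipticCurves.ModularForms.IsNewformOf W f ∧ ∃ (n : ℕ) (_ : NeZero n), Squarefree n ∧ n.primeFactors.card = W.mordellWeilRank ∧ (∀ ℓ ∈ n.primeFactors, ¬ ℓ ∣ N * p ∧ (ℓ : ZMod p) = 1 ∧ (W.frobeniusTrace ℓ : ZMod p) = 2) ∧ ∃ ψ : (ℓ : ℕ) → (ZMod ℓ)ˣ →* Multiplicative (ZMod p), (∀ ℓ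 ∈ n.primeFactors, Function.Surjective (ψ ℓ)) ∧ (∑ a : (ZMod n)ˣ, (Literature.NumberTheory.EllipticCurves.ratPlusSymbol f (((a : ZMod n).val : ℚ) / n) : ZMod p) * ∏ ℓ ∈ n.primeFactors.attach, Multiplicative.toAdd (ψ ℓ.1 (ZMod.unitsMap (Nat.dvd_of_mem_primeFactors ℓ.2) a))) ≠ 0

-- earlier Consistency (stmt-BirchSwinnertonDyer-15528, replaced 2026-08-16T15:46:34Z -> stmt-BirchSwinnertonDyer-15621): retired by None — ∀ (W : WeierstrassCurve ℚ) [W.IsElliptic] [W.IsGloballyMinimal] (p : ℕ) [Fact p.Prime], 5 ≤ p → Literature.NumberTheory.EllipticCurves.IsOrdinaryAt W p → ∀ (D : WeierstrassCurve.PAdicHeightData W p), D.IsCanonical → ∀ ⦃N : ℕ⦄ [NeZero N] (f : CuspForm (CongruenceS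
-- earlier Consistency (stmt-BirchSwinnertonDyer-15621, replaced 2026-08-16T16:28:09Z -> stmt-BirchSwinnertonDyer-16217): retired by None — ∀ (W : WeierstrassCurve ℚ) [W.IsElliptic] [W.IsGloballyMinimal] (p : ℕ) [Fact p.Prime], 5 ≤ p → Literature.NumberTheory.EllipticCurves.IsOrdinaryAt W p → ∀ (D : WeierstrassCurve.PAdicHeightData W p), D.IsCanonical → ∀ ⦃N : ℕ⦄ [NeZero N] (f : CuspForm (CongruenceS
/-- item stmt-BirchSwinnertonDyer-16217 · crux · rank 2 · SPLIT (gen 1) into ConsistencyNonDeficient, DeficientVanishing + glue ConsistencySplitGlue · direct attempts still welcome (low priority) · by planner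
why it might fail: At r_MW=2 it is the rank-2 p-adic Beilinson formula: needs an arithmetic avatar of L''(E,1) (none over ℚ); false at one (E,p) whose ∞- and p-adic BSD quotients differ, and for any E with r_an>r_MW, Ш[p^∞] finite and Reg_p≠0 at some p.
sources: arXiv:1910.07404, Conj 1.5 and Thm 1.8 (p. 5), Cor 1.10-1.11 (p. 6), arXiv:2103.11535, p. 2, Summits/BirchSwinnertonDyer/BirchSwinnertonDyer/Cruxes/Consistency/STRATEGY-CENSUS.md, Summits/BirchSwinnertonDyer/BirchSwinnertonDyer/Theorems/LeadingTermConsistencyBypass.lean, Summits/BirchSwinnertonDyer/BirchSwinnertonDyer/Theorems/LeadingTermConsistencyOfRT.lean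
[crux] LEADING-TERM CONSISTENCY at the algebraic rank (wild shadow of the 2001 archimedean–tame
consistency γ_(E,p) = ρ(E)): for every elliptic E/ℚ (globally minimal W), every good ordinary p ≥ 5,
the canonical cyclotomic p-adic height datum D and the newform f of E, with r := rank_ℤ E(ℚ): the
archimedean BSD quotient is well defined — Reg_∞(E) > 0 (Néron–Tate; tree theorem
regulator_pos_holds) and Ω⁺_f > 0 (tree theorem IsNewform0.plusPeriod_pos_holds; rev 5 cone repair:
folded in as a conjunct so the deciding theorem does not import the modular-curve genus files) — and
there is q ∈ ℚ with L^(r)(E,1) = r!·q·Ω⁺_f·Reg_∞(E) AND [T^r]L_p(f,α_p,T)·log_p(γ_cyc)^r =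
q·(1−α_p⁻¹)²·Reg_p(E,D) (both sides may vanish; r = 0 is the Mazur–Swinnerton-Dyer interpolation, r
= 1 = r_an is Perrin-Riou's p-adic Gross–Zagier). [difficulty: open-problem] -/
@[route_item "route-BirchSwinnertonDyer-LeadingTerm", crux]
def Consistency : Prop :=
  ∀ (W : WeierstrassCurve ℚ) [W.IsElliptic] [W.IsGloballyMinimal] (p : ℕ) [Fact p.Prime], 5 ≤ p → Literature.NumberTheory.EllipticCurves.IsOrdinaryAt W p → ∀ (D : WeierstrassCurve.PAdicHeightData W p), D.IsCanonical → ∀ ⦃N : ℕ⦄ [NeZero N] (f : CuspForm (CongruenceSubgroup.Gamma0 N) 2), Literature.NumberTheory.EllipticCurves.ModularForms.IsNewformOf W f → 0 < W.regulator ∧ 0 < Literature.NumberTheory.EllipticCurves.ModularForms.plusPeriod f ∧ ∃ q : ℚ, iteratedDeriv W.mordellWeilRank W.entireLFunction 1 = (((W.mordellWeilRank.factorial : ℝ) * (q : ℝ) * Literature.NumberTheory.EllipticCurves.ModularForms.plusPeriod f * W.regulator : ℝ) : ℂ) ∧ PowerSeries.coeff W.mordellWeilRank (Literature.NumberTheory.EllipticCurves.padicLFunction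 f (Literature.NumberTheory.EllipticCurves.unitRoot W p : ℚ_[p])) * Literature.NumberTheory.EllipticCurves.padicLog p (Literature.NumberTheory.EllipticCurves.cyclotomicGenerator p) ^ W.mordellWeilRank = (q : ℚ_[p]) * (1 - (Literature.NumberTheory.EllipticCurves.unitRoot W p : ℚ_[p])⁻¹) ^ 2 * WeierstrassCurve.padicRegulator D

-- parent: Consistency · child (gen 1)
/--     item stmt-BirchSwinnertonDyer-23292 · crux · rank 201 · open
    parent: Consistency · by planner
    why it might fail: Contains BSD-rationality L^{(r)}(E,1)/(r!·Ω⁺_f·Reg_∞) ∈ ℚ for r_MW = r_an ≥ 2 (Tate 1974 Conj 4(b) mod ℚ^×; no arithmetic avatar of L''(E,1)) + the rank-≥2 p-adic Beilinson formula; false at one diagonal (E,p) whose archimedean and p-adic BSD quotients differ.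
    sources: arXiv:1910.07404, arXiv:2103.11535, PerrinRiou1987, MazurTateTeitelbaum1986Invent, MazurSteinTate2006, SteinWuthrich2013
[crux] CHILD A of Consistency (crux-strategist split s1 2026-08-17 / installed r1 2026-08-28; cut
along the sign of r_an − r_MW): LEADING-TERM CONSISTENCY ON THE NON-DEFICIENT CELLS r_an ≤ r_MW —
the crux verbatim with the extra hypothesis W.analyticRank ≤ W.mordellWeilRank. On the diagonal r_an
= r_MW it is the p-adic Beilinson identity WITH ITS RATIONAL CONSTANT q (r = 0:
Mazur–Swinnerton-Dyer interpolation, tree theorem leadingTerm_consistency_of_rank_zero; r = 1: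
Perrin-Riou 1987 = support RankLeOne; r ≥ 2: OPEN = stub S2 of lines Sketch/birth/ladder-rank2 = (R)
BSD-rationality at the rank ∧ (T) the p-adic transfer given the constant, Burns–Kurihara–Sano Conj.
1.5 / Cor. 1.10); the excess cells r_an < r_MW are emptied by crux SqueezeUBR2. LANDED
(Theorems/LeadingTermConsistencySplit.lean p661901 + LeadingTermConsistencySplitChildA.lean p661974,
0 sorries): Consistency → ConsistencyNonDeficient (nonDeficient_of_consistency); SqueezeUBR2 →
RankLeOne → (ConsistencyNonDeficient ↔ diagonal r ≥ 2) (nonDeficient_iff_diagonalTwoLe_of_items);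
ConsistencyNonDeficient → BSD-rationality L^{(r)}(E,1) ∈ ℚ·r!·Ω⁺_f·Reg_∞ in rank ≥ 2
(rationality_of_nonDeficient) — refined-BSD content the summi -/
@[route_item "route-BirchSwinnertonDyer-LeadingTerm", crux]
def ConsistencyNonDeficient : Prop :=
  ∀ (W : WeierstrassCurve ℚ) [W.IsElliptic] [W.IsGloballyMinimal] (p : ℕ) [Fact p.Prime], 5 ≤ p → Literature.NumberTheory.EllipticCurves.IsOrdinaryAt W p → ∀ (D : WeierstrassCurve.PAdicHeightData W p), D.IsCanonical → ∀ ⦃N : ℕ⦄ [NeZero N] (f : CuspForm (CongruenceSubgroup.Gamma0 N) 2), Literature.NumberTheory.EllipticCurves.ModularForms.IsNewformOf W f → W.analyticRank ≤ W.mordellWeilRank → 0 < W.regulator ∧ 0 < Literature.NumberTheory.EllipticCurves.ModularForms.plusPeriod f ∧ ∃ q : ℚ, iteratedDeriv W.mordellWeilRank W.entireLFunction 1 = (((W.mordellWeilRank.factorial : ℝ) * (q : ℝ) * Literature.NumberTheory.EllipticCurves.ModularForms.plusPeriod f * W.regulator : ℝ) : ℂ) ∧ PowerSeries.coeff W.mordellWeilRank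 (Literature.NumberTheory.EllipticCurves.padicLFunction f (Literature.NumberTheory.EllipticCurves.unitRoot W p : ℚ_[p])) * Literature.NumberTheory.EllipticCurves.padicLog p (Literature.NumberTheory.EllipticCurves.cyclotomicGenerator p) ^ W.mordellWeilRank = (q : ℚ_[p]) * (1 - (Literature.NumberTheory.EllipticCurves.unitRoot W p : ℚ_[p])⁻¹) ^ 2 * WeierstrassCurve.padicRegulator D

-- parent: Consistency · child (gen 1)
/--     item stmt-BirchSwinnertonDyer-23293 · crux · rank 202 · open
    parent: Consistency · by planner
    why it might fail: In a matched-parity cell (r_MW,r_an) = (r,r+2k), r ≥ 2 — first (2,4) — it is the rank-r p-converse: a rank-2 curve with r_an = 4, Ш[p^∞] finite and non-degenerate height has ord_T L_p = 2 (IMC + Schneider) and violates it; no engine beyond corank 1 (SelmerRankBarrier).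
    sources: Kato2004Asterisque, Thm 18.4 (p. 281), SkinnerUrban2014, Schneider1985, PerrinRiou1987, arXiv:1910.07404, Literature.Barriers.BirchSwinnertonDyer.SelmerRankBarrier
[crux] CHILD B of Consistency (crux-strategist split s1 2026-08-17 / installed r1 2026-08-28):
DEFICIENT VANISHING — for every elliptic E/ℚ (globally minimal W), every good ordinary p ≥ 5 and the
newform f of E: if rank_ℤ E(ℚ) < ord_{s=1} L(E,s) then the r_MW-th Taylor coefficient of L_p(f, α_p,
T) vanishes (ord_{T=0} L_p > r_MW whenever ord_{s=1} L > r_MW; an ∞→p transfer of VANISHING at the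
single index r_MW; D-free). This is the ONLY part of the crux the deciding theorem consumes:
DeficientVanishing → PinchPrime → SqueezeUBR2 → BirchSwinnertonDyer is LANDED
(bsd_of_pinchPrime_of_deficientVanishing p135377;
bsd_of_deficientVanishing_of_pinchPrime_of_squeezeUB p661901), so a tenure planner may re-decide
closes on this child with proof `exact Theorems.bsd_of_deficientVanishing_of_pinchPrime_of_squeezeUB
hDV hP hUB`. WITHIN the summit: BirchSwinnertonDyer → DeficientVanishing (deficientVanishing_of_bsd
p661901; probe 2026-08-28: VERDICT CLEAN, C→S fails, S→C informational). Status by cells: r_MW = 0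
PROVED (interpolation); mismatched parity PROVED from Kato's rank bound + the p-adic functional
equation (coeff_padicLFunction_eq_zero_of_katoSide_of_mismatch); (1, odd ≥ 3) = rank-1 p-c -/
@[route_item "route-BirchSwinnertonDyer-LeadingTerm", crux]
def DeficientVanishing : Prop :=
  ∀ (W : WeierstrassCurve ℚ) [W.IsElliptic] [W.IsGloballyMinimal] (p : ℕ) [Fact p.Prime], 5 ≤ p → Literature.NumberTheory.EllipticCurves.IsOrdinaryAt W p → ∀ ⦃N : ℕ⦄ [NeZero N] (f : CuspForm (CongruenceSubgroup.Gamma0 N) 2), Literature.NumberTheory.EllipticCurves.ModularForms.IsNewformOf W f → W.mordellWeilRank < W.analyticRank → PowerSeries.coeff W.mordellWeilRank (Literature.NumberTheory.EllipticCurves.padicLFunction f (Literature.NumberTheory.EllipticCurves.unitRoot W p : ℚ_[p])) = 0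

-- parent: Consistency · glue (gen 1)
/--     item stmt-BirchSwinnertonDyer-23294 · support · rank 203 · closed · proved by Summit.BirchSwinnertonDyer.BirchSwinnertonDyer.Theorems.consistencySplitGlue_holds (planner)
    parent: Consistency · GLUE: children ⟹ parent · by planner
GLUE of the strategist split of crux #2 Consistency (exact partition along the sign of r_an − r_MW):
ConsistencyNonDeficient → DeficientVanishing → Consistency. PROVED AND LANDED:
Summit.BirchSwinnertonDyer.BirchSwinnertonDyer.Theorems.consistency_of_nonDeficient_of_deficientVanishing
(Theorems/LeadingTermConsistencySplit.lean, p661901, commit 6e7c4c927245; 0 sorries; children and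
crux spelled out verbatim, so this item closes by `theorem consistencySplitGlue_holds :
ConsistencySplitGlue := fun hA hB =>
Summit.BirchSwinnertonDyer.BirchSwinnertonDyer.Theorems.consistency_of_nonDeficient_of_deficientVanishing
hA hB` in a Theorems file importing Theorems.LeadingTermConsistencySplit). Not installed via
--glue-by only because that module (through Theorems.LeadingTermConsistencyCells:
regulator_pos_holds, IsNewform0.plusPeriod_pos_holds) transitively imports this route file; a
standalone re-proof would pull RegulatorProofs + ModularFormsGamma0Genus (+47 modules) into the
route's import cone (rev-5 hygiene). Exactness (no child stronger than the crux):
consistency_iff_nonDeficient_and_deficientVanishing (same file). -/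
@[route_item "route-BirchSwinnertonDyer-LeadingTerm"]
def ConsistencySplitGlue : Prop :=
  ConsistencyNonDeficient → DeficientVanishing → Consistency

-- `ConsistencySplitGlue` holds: proved by `Summit.BirchSwinnertonDyer.BirchSwinnertonDyer.Theorems.consistencySplitGlue_holds` (its module imports this route file, so no `_holds` link can be stated here).

-- earlier PinchPrime (stmt-BirchSwinnertonDyer-15529, replaced 2026-08-16T16:28:09Z -> stmt-BirchSwinnertonDyer-16218): retired by None — ∀ (W : WeierstrassCurve ℚ) [W.IsElliptic] [W.IsGloballyMinimal], ∃ (p : ℕ) (_ : Fact p.Prime), 5 ≤ p ∧ Literature.NumberTheory.EllipticCurves.IsOrdinaryAt W p ∧ ∃ (N : ℕ) (_ : NeZero N) (f : CuspForm (CongruenceSubgroup.Gamma0 N) 2), Literature.NumberTheory.Ellipt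
/-- item stmt-BirchSwinnertonDyer-16218 · crux · rank 3 · open · by planner
why it might fail: Fails iff some E has, at EVERY good ordinary p≥5, divisible Ш[p^∞] or a degenerate cyclotomic height (or IMC inexact at small image); certified only curve by curve (elliptic-Wieferich obstruction to any 'infinitely many p' theorem).
sources: Schneider1985, Kato2004, SkinnerUrban2014, arXiv:2412.20078, SteinWuthrich2013, MazurSteinTate2006
[crux] ONE PINCH PRIME PER CURVE (2001 sha-finiteness-first 'pinch', ∃-form of PAdicOrderV2#3):
every elliptic E/ℚ (globally minimal W) has a good ordinary prime p ≥ 5 — carried with its canonical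
cyclotomic p-adic height datum D (rev 5 cone repair: a witness of the crux; it exists at every good
ordinary p ≥ 5 by the tree theorem exists_isCanonical_holds, so the ∃D clause is free for a prover
and keeps CanonicalPAdicHeightHolds out of the route's imports) — with ord_(T=0) L_p(f,α_p,T) =
rank_ℤ E(ℚ) for the newform f of E (by Kato ord_T L_p ≥ rank always; equality ⟺ IMC-exactness ∧
#Ш(E)[p^∞] < ∞ ∧ Schneider non-degeneracy at that ONE p). [difficulty: open-problem] -/
@[route_item "route-BirchSwinnertonDyer-LeadingTerm", crux]
def PinchPrime : Prop :=
  ∀ (W : WeierstrassCurve ℚ) [W.IsElliptic] [W.IsGloballyMinimal], ∃ (p : ℕ) (_ : Fact p.Prime), 5 ≤ p ∧ Literature.NumberTheory.EllipticCurves.IsOrdinaryAt W p ∧ ∃ (D : WeierstrassCurve.PAdicHeightData W p), D.IsCanonical ∧ ∃ (N : ℕ) (_ : NeZero N) (f : CuspForm (CongruenceSubgroup.Gamma0 N) 2), Literature.NumberTheory.EllipticCurves.ModularForms.IsNewformOf W f ∧ (Literature.NumberTheory.EllipticCurves.padicLFunction f (Literature.NumberTheory.EllipticCurves.unitRoot W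 p : ℚ_[p])).order = W.mordellWeilRank

/-- item stmt-BirchSwinnertonDyer-0145 · crux · rank 4 · SPLIT (gen 1) into SelmerCapAtOnePrime, GZKRankLeOne + glue Summit.BirchSwinnertonDyer.BirchSwinnertonDyer.Theorems.squeezeUB_of_selmerCapAtOnePrime_of_rankLeOne_statement · direct attempts still welcome (low priority) · by planner
why it might fail: One excess-rank curve (k exhibited independent points and a certified L^(m)(E,1) ≠ 0, m < k) refutes it and BSD; for r_an ≥ 2 only rank ≤ corank Sel ≤ ord_T L_p is known (Kato 18.4), the step to ord_s L is open.
sources: Kolyvagin1990, Kato2004, SkinnerUrban2014, Literature.Barriers.BirchSwinnertonDyer.SelmerRankBarrier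
Upper bound: the Mordell–Weil rank never exceeds the analytic rank. Known when r_an ≤ 1
(Kolyvagin1990; Kato2004 Thm 14.2 for r_an = 0). Shared verbatim with HigherGrossZagier (dedup). Its
negation is Squeeze#6. imports: Summits.BirchSwinnertonDyer.Statement,
Literature.NumberTheory.EllipticCurves.{Selmer,Sha,Heights,GaloisAction,Tamagawa,BSDInvariants}
(routes/Sketch.lean, lean check rc 0 on 2026-08-13). -/
@[route_item "route-BirchSwinnertonDyer-LeadingTerm", crux]
def SqueezeUBR2 : Prop :=
  ∀ (W : WeierstrassCurve ℚ) [W.IsElliptic], W.mordellWeilRank ≤ W.analyticRank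

-- parent: SqueezeUBR2 · child (gen 1)
/--     item stmt-BirchSwinnertonDyer-19215 · crux · rank 401 · open
    parent: SqueezeUBR2 · by planner
    why it might fail: Fails iff some E with r_an ≥ 2 has corank Sel_{p^∞} > r_an at EVERY prime (excess rank, or Ш[p^∞] of positive corank for all p); for r_an ≥ 2 no uniform mechanism bounds a Selmer corank by ord_{s=1} L(E,s) (SelmerRankBarrier); true curve-by-curve by descent.
    sources: arXiv:2203.12159, Kato2004Asterisque, Greenberg1999LNM, SteinWuthrich2013, Cremona1997, Literature.Barriers.BirchSwinnertonDyer.SelmerRankBarrier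
[crux] C3 of the card: for every E/ℚ (globally minimal W) of analytic rank ≥ 2 there is a prime p
with corank_(ℤ_p) Sel_(p^∞)(E/ℚ) ≤ ord_(s=1) L(E,s); non-CM: a non-zero Kurihara number δ̃_n mod p^k
on a Kolyvagin product n with ν(n) ≤ r_an certifies it (Kim2022StructureSelmer Thm 1.9(1), tree fact
Kim2022_selmerCorank_le_of_kuriharaNumber_ne_zero); CM: Rubin1991. [difficulty: XL] -/
@[route_item "route-BirchSwinnertonDyer-LeadingTerm", crux]
def SelmerCapAtOnePrime : Prop :=
  ∀ (W : WeierstrassCurve ℚ) [W.IsElliptic] [W.IsGloballyMinimal], 2 ≤ W.analyticRank → ∃ (p : ℕ) (_ : Fact p.Prime), W.selmerCorank p ≤ W.analyticRank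

-- parent: SqueezeUBR2 · child (gen 1)
/--     item stmt-BirchSwinnertonDyer-17525 · support · rank 402 · open
    parent: SqueezeUBR2 · by planner
    sources: GrossZagier1986, Kolyvagin1990, BumpFriedbergHoffstein1990, MurtyMurty1991, Kato2004Asterisque
[support] the known cases (calibration, d ≤ 1 of the plectic principle): r_an(E) ≤ 1 ⇒ r_an(E) =
rank E(ℚ) (Gross–Zagier 1986 + Kolyvagin 1990 with a non-vanishing quadratic twist; Kato 2004 for
r_an = 0). [difficulty: XL] -/
@[route_item "route-BirchSwinnertonDyer-LeadingTerm", crux]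
def GZKRankLeOne : Prop :=
  ∀ (W : WeierstrassCurve ℚ) [W.IsElliptic], W.analyticRank ≤ 1 → W.analyticRank = W.mordellWeilRank

/-- glue for the split of `SqueezeUBR2`: landed theorem `Summit.BirchSwinnertonDyer.BirchSwinnertonDyer.Theorems.squeezeUB_of_selmerCapAtOnePrime_of_rankLeOne_statement`. -/
theorem SqueezeUBR2GlueBy_holds : SelmerCapAtOnePrime → GZKRankLeOne → SqueezeUBR2 := _root_.Summit.BirchSwinnertonDyer.BirchSwinnertonDyer.Theorems.squeezeUB_of_selmerCapAtOnePrime_of_rankLeOne_statement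

/-- item stmt-BirchSwinnertonDyer-0491 · support · rank 5 · open · by planner
why it might fail: A THEOREM in print (Kato 2004 Thm 18.4 'In particular'); corollary of crux KatoCorankBound (stmt-18048) by the proved Kummer identity; open only as a formalisation of kato_divisibility (Thm 17.4).
sources: Kato2004Asterisque, Thm 18.4 (p. 281), Thm 17.4 (p. 273), §17.13 (pp. 279-280), Rubin2000, Thms 2.3.2-2.3.4, Delbourgo2008, p. 42, GreenbergLNM1716, Thm 1.5 and §4, Literature.NumberTheory.EllipticCurves.kato_mordellWeilRank_le_order_padicLFunction, Literature.NumberTheory.EllipticCurves.kato_divisibility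
SUPERSEDES stmt-BirchSwinnertonDyer-0139 (r2). The old item was FALSELY closed 2026-08-13T06:58:11Z
by the gate decides-probe of p2749 as 'proved' by
Literature.EllArith.HigherGrossZagierDatum.leadingLCoeff_eq / det_ne_zero_of_leadingLCoeff_ne_zero —
lemmas taking (D : HigherGrossZagierDatum W W.analyticRank) as hypothesis, which cannot inhabit this
Prop (the same probe 'proved' both old 0145 and its negation-side 0257). Statement, rank and route
unchanged; grounder/refuter notes on stmt-BirchSwinnertonDyer-0139 remain valid and should be
copied, not redone. Near-Literature inequality validating all normalisations: rank ≤ corank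
Sel_{p^∞} (Kummer) ≤ ord_T char_Λ X(E/ℚ_∞) (Mazur control, Greenberg1999 §4) ≤ ord_T L_p (Kato2004
Thm 17.4 divisibility in Λ⊗ℚ_p = Literature.NumberTheory.EllipticCurves.kato_divisibility). Rubin,
Euler Systems, needs p ≠ 2. imports: Summits.BirchSwinnertonDyer.Statement,
Literature.NumberTheory.EllipticCurves.PAdicBSD (routes/SketchPAdic.lean). NOT elaborated at filing
time: DiophantineGeometry/Conductor.olean missing from the shared build (import fails before the
term is read); every constant checked against source. Refuter: re-check after rebuild. -/
@[route_item "route-BirchSwinnertonDyer-LeadingTerm", crux]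
def PAdicOrderKatoSideR2 : Prop :=
  ∀ (W : WeierstrassCurve ℚ) [W.IsElliptic] [W.IsGloballyMinimal] (p : ℕ) [Fact p.Prime], p ≠ 2 → Literature.NumberTheory.EllipticCurves.IsOrdinaryAt W p → ∀ {N : ℕ} [NeZero N] (f : CuspForm (CongruenceSubgroup.Gamma0 N) 2), Literature.NumberTheory.EllipticCurves.ModularForms.IsNewformOf W f → (W.mordellWeilRank : ℕ∞) ≤ (Literature.NumberTheory.EllipticCurves.padicLFunction f (Literature.NumberTheory.EllipticCurves.unitRoot W p : ℚ_[p])).order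

/-- item stmt-BirchSwinnertonDyer-18048 · support · rank 5 · open · by planner
why it might fail: A THEOREM in print (Kato 2004 Thm 18.4, corank form), open only as a FORMALISATION: its one proof is the XL fact kato_divisibility (Thm 17.4 (1)+(2): Beilinson–Kato Euler system + explicit reciprocity). Typed in ℕ∞ at odd good ordinary p with the tree's L_p, zpCorank: only a convention slip bites.
sources: Kato2004Asterisque, Thm 18.4 (p. 281), Thm 17.4 (p. 273), §17.13 (pp. 279-280), Rubin2000, Thms 2.3.2-2.3.4, GreenbergLNM1716, Thm 1.5, §1 p. 65 and §4, Delbourgo2008, p. 42, Literature.NumberTheory.EllipticCurves.kato_selmerCorank_le_order_padicLFunction, Literature.NumberTheory.EllipticCurves.kato_selmerCorank_le_order_padicLFunction_of_kato_divisibility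
[crux] KATO'S SELMER-CORANK BOUND (route-choice rchoice-21073028: the route's explicit Kato input —
the XL-apex fact kato_divisibility PROMOTED to a crux in the consequence actually consumed by stub
S1b): for every elliptic E/ℚ (globally minimal W), every ODD good ordinary prime p and the newform f
of E, corank_{ℤ_p} Sel_{p^∞}(E/ℚ) ≤ ord_{T=0} L_p(f,α_p,T) in ℕ∞ — K. Kato, Astérisque 295 (2004),
Thm 18.4 (p. 281) as printed (non-exceptional clause, k = 2, K = ℚ, α the unit root); literally the
∀-closure over (W, p, N, f) of the Literature named fact kato_selmerCorank_le_order_padicLFunction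
(KatoRankBound.lean), spelled out (the fact's def is NOT referenced, so the used-constants cone
stays proved; NEEDS ONE IMPORT for WeierstrassCurve.selmerCorank:
Literature.NumberTheory.EllipticCurves.Selmer — module cone +3 files Selmer/Sha/TateModule, every
named fact of which has a _holds: 0 new unproved census entries; planner Sketch.lean rc 0). ROLE:
(a) Kato input of stub S1b (stub_deficient_two_le_match: deficient cells 2 ≤ r_MW < r_an of matched
parity) of line Sketch of crux #2 Consistency — the landed closure
stub_deficient_two_le_match_of_selmerSide_of_kato_divisibility (Theorems/Lead -/
@[route_item "route-BirchSwinnertonDyer-LeadingTerm", crux]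
def KatoCorankBound : Prop :=
  ∀ (W : WeierstrassCurve ℚ) [W.IsElliptic] [W.IsGloballyMinimal] (p : ℕ) [Fact p.Prime], p ≠ 2 → Literature.NumberTheory.EllipticCurves.IsOrdinaryAt W p → ∀ {N : ℕ} [NeZero N] (f : CuspForm (CongruenceSubgroup.Gamma0 N) 2), Literature.NumberTheory.EllipticCurves.ModularForms.IsNewformOf W f → (WeierstrassCurve.selmerCorank W p : ℕ∞) ≤ (Literature.NumberTheory.EllipticCurves.padicLFunction f (Literature.NumberTheory.EllipticCurves.unitRoot W p : ℚ_[p])).order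

/-- item stmt-BirchSwinnertonDyer-18082 · aside · rank 5 · open · by planner
why it might fail: THEOREM in print (Kato 2004 Thm 17.4(1)(2)); open only as XL FORMALISATION (Beilinson–Kato Euler system 12.5, Iwasawa cohomology 12.4, Coleman map/reciprocity 16.6+17.11: none in Mathlib). As typed (∀ cyclotomic data, ι g = p^n·L_p(f,α_p) exactly, odd good ordinary p incl. CM) only a γ↔T slip bites.
sources: Kato2004Asterisque, Thm 17.4 (1)-(2) (p. 273), §17.13 (pp. 279-280), Thm 12.4-12.5 (pp. 221-222), Thm 16.6 (p. 271), Prop 17.11 (p. 277), Rubin2000, Thms 2.3.2-2.3.4, GreenbergLNM1716, §1 p. 65 and §3 Lemma 3.1, MazurTateTeitelbaum1986Invent, §I.13 (T-variable), Literature.NumberTheory.EllipticCurves.kato_divisibility, Literature.NumberTheory.EllipticCurves.Kato2004.kato_divisibility_conclusions_of_skeleton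
[crux] KATO'S DIVISIBILITY — K. Kato, Astérisque 295 (2004), Thm 17.4 (1)–(2) (p. 273) for E/ℚ
(route-choice rchoice-7f99c112: the XL-apex Literature fact kato_divisibility PROMOTED to a crux in
the form CONSUMED by line `Sketch` of crux #2 Consistency —
Theorems/LeadingTermConsistencyLocusSplit (bad-locus vanishing badLocus_coeff_eq_zero_of_facts +
necessity of the Ш-transfer shaTransfer_of_consistency_of_facts) — and, through PROVED tree
theorems, implying the route's two Kato bounds KatoCorankBound (stmt-18048, Thm 18.4 corank form,
stub S1b) and PAdicOrderKatoSideR2 (stmt-0491, rank form, stub S1m): ONE Kato crux for the whole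
line). STATEMENT: for every elliptic E/ℚ (globally minimal W), every ODD good ordinary prime p, the
cyclotomic ℤ_p-extension κ of ℚ with topological generator γ matching the variable T of L_p
(IsCyclotomicVariable), the newform f of E and ANY Pontryagin-dual datum D of Sel_{p^∞}(E/ℚ_∞) (Λ =
ℤ_p⟦T⟧, T = γ − 1): (1) X = D.X is Λ-torsion and (2) char_Λ X ∣ L_p(E,T) in Λ ⊗ ℚ_p, i.e. p^n ·
L_p(f, α_p, T) = ι g for some n ≥ 0 and some g ∈ char_Λ X (ι = iwasawaToPowerSeries; the
ideal-theoretic translation of Kato's 'length_{Λ_𝔭} X_𝔭 ≤ ord_𝔭 L_{p-adic} for every -/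
@[route_item "route-BirchSwinnertonDyer-LeadingTerm", crux]
def KatoDivisibility : Prop :=
  ∀ (W : WeierstrassCurve ℚ) [W.IsElliptic] [W.IsGloballyMinimal] (p : ℕ) [Fact p.Prime], p ≠ 2 → Literature.NumberTheory.EllipticCurves.IsOrdinaryAt W p → ∀ (κ : Literature.NumberTheory.EllipticCurves.ZpExtension ℚ p) (γ : Field.absoluteGaloisGroup ℚ), κ.IsCyclotomic → κ.IsTopGenerator γ → Literature.NumberTheory.EllipticCurves.IsCyclotomicVariable p γ → ∀ {N : ℕ} [NeZero N] (f : CuspForm (CongruenceSubgroup.Gamma0 N) 2), Literature.NumberTheory.EllipticCurves.ModularForms.IsNewformOf W f → ∀ (D : W.SelmerDualData κ γ), D.IsTorsion ∧ ∃ (n : ℕ) (g : Literature.NumberTheory.EllipticCurves.IwasawaAlgebra p), g ∈ D.charIdeal ∧ Literature.NumberTheory.EllipticCurves.iwasawaToPowerSeries p g = PowerSeries.C ((p : ℚ_[p]) ^ n) * Literature.NumberTheory.EllipticCurves.padicLFunction f (Literature.NumberTheory.EllipticCurves.unitRoot W p : ℚ_[p])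

/-- item stmt-BirchSwinnertonDyer-17975 · support · rank 6 · open · by planner
[crux — child S′ of PinchPrime, crux-strategist split 2026-08-17; = registered stub
`stub_schneiderIO_of_pos_rank` of line SketchIdeator2 VERBATIM] SCHNEIDER NON-DEGENERACY INFINITELY
OFTEN: every elliptic E/ℚ (globally minimal W) of Mordell–Weil rank ≥ 1 that is not a CM curve of
rank 1 has, outside any finite set of primes, a good ordinary p ≥ 5 at which THE canonical
cyclotomic p-adic height (Dh.IsCanonical: unique by isCanonical_unique, exists by
exists_isCanonical_holds — so the ∀ Dh clause is neither vacuous nor a choice) is non-degenerate,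
Reg_p(E) ≠ 0 (WeierstrassCurve.SchneiderConjecture Dh := padicRegulator Dh ≠ 0). The ∃^∞p weakening
of Mazur–Stein–Tate 2006 Conj. 1.1 (held: doi:10.4171/dms/4/17 p. 4) on exactly its open range: rank
0 is Reg_p = det ∅ = 1 (landed schneider_of_mordellWeilRank_eq_zero), CM rank 1 is Bertrand 1984
(landed G8 + Literature fact bertrand_pairing_self_ne_zero_of_hasCM), both supplied by the glue
item. In rank 1 = r_an it reads: h_p(P) ≠ 0 for the generator at infinitely many good ordinary p (⟺
L_p′(E,0) ≠ 0 by Perrin-Riou's p-adic Gross–Zagier) — barrier note B6: open even there for non-CM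
curves; the height is h_p(Q) = (1/p) log_p(σ_p(Q)/d(Q)) -/
@[route_item "route-BirchSwinnertonDyer-LeadingTerm"]
def SchneiderInfinitelyOftenOfPosRank : Prop :=
  ∀ (W : WeierstrassCurve ℚ) [W.IsElliptic] [W.IsGloballyMinimal], 1 ≤ W.mordellWeilRank → (W.HasCM → 2 ≤ W.mordellWeilRank) → ∀ B : Finset ℕ, ∃ p ∉ B, ∃ _ : Fact p.Prime, 5 ≤ p ∧ Literature.NumberTheory.EllipticCurves.IsOrdinaryAt W p ∧ ∀ Dh : WeierstrassCurve.PAdicHeightData W p, Dh.IsCanonical → WeierstrassCurve.SchneiderConjecture Dh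

/-- item stmt-BirchSwinnertonDyer-17976 · support · rank 7 · open · by planner
[crux — child A′ of PinchPrime, crux-strategist split 2026-08-17; = registered stub
`stub_cofiniteShaFinite_of_two_le_analyticRank` of line SketchIdeator2 VERBATIM] COFINITE
Ш-FINITENESS IN ANALYTIC RANK ≥ 2: for every elliptic E/ℚ (globally minimal W) with ord_{s=1} L(E,s)
≥ 2, Ш(E/ℚ)[p^∞] is finite for all but finitely many good ordinary primes p. The Ш-leg of the pinch
on exactly its open range (analytic rank ≤ 1 is Gross–Zagier–Kolyvagin, which the glue item supplies
as a fact); a range restriction of the Tate–Shafarevich conjecture and IMPLIED by the shared item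
SelmerRankShaPFinite (∀ W p, Finite Ш[p^∞]; routes SelmerRank/FrozenTwin) with B = ∅
(Cruxes/PinchPrime/SplitCertificate.lean `leadingTermPinchPrime_childSha_of_shaPFinite`, proved) —
it is that item's honest residual after Kolyvagin, stated cofinitely over good ordinary p because
that is the shape any Euler-system engine delivers. Meets the height child at a common prime by
Infinite ∩ cofinite (barrier note B1: two ∃p legs would not meet). Estimate: {lines_est: n/a (open
problem — no Euler-system class for r_an ≥ 2: HeegnerPointBarrier; Castella–Hsieh arXiv:1809.09066
is one p at a time under a hypothesis equivalent t -/
@[route_item "route-BirchSwinnertonDyer-LeadingTerm"]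
def ShaFiniteCofiniteOfTwoLeAnalyticRank : Prop :=
  ∀ (W : WeierstrassCurve ℚ) [W.IsElliptic] [W.IsGloballyMinimal], 2 ≤ W.analyticRank → ∃ B : Finset ℕ, ∀ p ∉ B, ∀ [Fact p.Prime], Literature.NumberTheory.EllipticCurves.IsOrdinaryAt W p → Finite (AddCommGroup.primaryComponent W.sha p)

-- earlier LBOfCruxes (stmt-BirchSwinnertonDyer-15533, replaced 2026-08-16T15:46:34Z -> stmt-BirchSwinnertonDyer-15623): retired by None — Consistency → PinchPrime → PeriodRegulatorPos → ∀ (W : WeierstrassCurve ℚ) [W.IsElliptic], iteratedDeriv W.mordellWeilRank W.entireLFunction 1 ≠ 0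
/-- item stmt-BirchSwinnertonDyer-15623 · support · rank 9 · closed · proved by Summit.BirchSwinnertonDyer.BirchSwinnertonDyer.Theorems.leadingTerm_lbOfCruxes_proof @ 6d1df48e0d44 (prover) · by planner
sources: MazurTateTeitelbaum1986Invent, SilvermanAEC2009
[support] GLUE cruxes → LB_∞ (provable now; it is the first half of the deciding theorem):
Consistency → PinchPrime → for every elliptic W, iteratedDeriv (rank W) L_W 1 ≠ 0 (global minimal
model, pinch prime, canonical height exists — exists_isCanonical_holds —, [T^r]L_p ≠ 0 by
PowerSeries.order_eq_nat, log_p γ ≠ 0, hence q ≠ 0; Ω⁺_f > 0 by IsNewform0.plusPeriod_pos_holds and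
Reg_∞ > 0 from Consistency give the archimedean side ≠ 0; transport back by isomorphism invariance
of rank and L-function). -/
@[route_item "route-BirchSwinnertonDyer-LeadingTerm"]
def LBOfCruxes : Prop :=
  Consistency → PinchPrime → ∀ (W : WeierstrassCurve ℚ) [W.IsElliptic], iteratedDeriv W.mordellWeilRank W.entireLFunction 1 ≠ 0

-- `LBOfCruxes` holds: proved by `Summit.BirchSwinnertonDyer.BirchSwinnertonDyer.Theorems.leadingTerm_lbOfCruxes_proof` @ 6d1df48e0d44 (its module imports this route file, so no `_holds` link can be stated here).

-- item stmt-BirchSwinnertonDyer-15715 · aside · rank 9 · open · by planner — informal only, no Lean statement yet: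
--   [crux — TAME FORM, untyped] TAME CONSISTENCY, the intended Schneider-free form of crux #2
--   Consistency (2001 archimedean-tame-consistency Thm A(b)/F and Prop.(2); reciprocity-law-class-lift
--   Thm A; Mazur–Tate 1987 Conj. 4 read with the ARCHIMEDEAN constant): for every elliptic E/ℚ, every
--   admissible prime p (good ordinary, p ≥ 5, ρ̄_{E,p} surjective, non-anomalous, p ∤ Tam(E)·#E(ℚ)_tors,
--   Manin constant prime to p) with Ш(E)[p] = 0, and every generic square-free product n = ℓ_1⋯ℓ_r of r
--   = rank_ℤ E(ℚ) Kolyvagin primes for p^k (ℓ ∤ Np, ℓ ≡ 1 and a_ℓ ≡ ℓ + 1 mod p^k): the Kurihara number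
--   δ_n = Σ_{a ∈

-- earlier RankLeOne (stmt-BirchSwinnertonDyer-15531, replaced 2026-08-16T15:46:34Z -> stmt-BirchSwinnertonDyer-15622): retired by None — ∀ (W : WeierstrassCurve ℚ) [W.IsElliptic] [W.IsGloballyMinimal] (p : ℕ) [Fact p.Prime], 5 ≤ p → Literature.NumberTheory.EllipticCurves.IsOrdinaryAt W p → W.mordellWeilRank ≤ 1 → W.analyticRank = W.mordellWeilRank → ∀ (D : WeierstrassCurve.PAdicHeightData W p), D.Is
-- earlier RankLeOne (stmt-BirchSwinnertonDyer-15622, replaced 2026-08-16T16:28:09Z -> stmt-BirchSwinnertonDyer-16219): retired by None — ∀ (W : WeierstrassCurve ℚ) [W.IsElliptic] [W.IsGloballyMinimal] (p : ℕ) [Fact p.Prime], 5 ≤ p → Literature.NumberTheory.EllipticCurves.IsOrdinaryAt W p → W.mordellWeilRank ≤ 1 → W.analyticRank = W.mordellWeilRank → ∀ (D : WeierstrassCurve.PAdicHeightData W p), D.Is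
/-- item stmt-BirchSwinnertonDyer-16219 · aside · rank 9 · open · by planner
sources: PerrinRiou1987, GrossZagier1986, Kolyvagin1990, MazurTateTeitelbaum1986Invent, Kobayashi2013
[support] the KNOWN slice of Consistency (literature leaf, not in the deciding theorem): rank_ℤ E(ℚ)
≤ 1 and r_an = r_MW ⇒ Consistency at (E,p), Reg_∞ > 0 and Ω⁺_f > 0 included (rev 5: mirrors the
restated Consistency) — r = 0 is the interpolation L_p(E,0) = (1−α⁻¹)² L(E,1)/Ω⁺_f
(Mazur–Swinnerton-Dyer), r = 1 is Perrin-Riou's p-adic Gross–Zagier (both sides are heights of the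
same Heegner point; Gross–Zagier + Kolyvagin + a non-vanishing twist); adapt
reserve/prior-2001/Prior/BirchSwinnertonDyer/BirchSwinnertonDyer/Bsd_ArchimedeanTameConsistency_MTKurihara.lean
for the bookkeeping. [difficulty: XL] -/
@[route_item "route-BirchSwinnertonDyer-LeadingTerm", crux]
def RankLeOne : Prop :=
  ∀ (W : WeierstrassCurve ℚ) [W.IsElliptic] [W.IsGloballyMinimal] (p : ℕ) [Fact p.Prime], 5 ≤ p → Literature.NumberTheory.EllipticCurves.IsOrdinaryAt W p → W.mordellWeilRank ≤ 1 → W.analyticRank = W.mordellWeilRank → ∀ (D : WeierstrassCurve.PAdicHeightData W p), D.IsCanonical → ∀ ⦃N : ℕ⦄ [NeZero N] (f : CuspForm (CongruenceSubgroup.Gamma0 N) 2), Literature.NumberTheory.EllipticCurves.ModularForms.IsNewformOf W f → 0 < W.regulator ∧ 0 < Literature.NumberTheory.EllipticCurves.ModularForms.plusPeriod f ∧ ∃ q : ℚ, iteratedDeriv W.mordellWeilRank W.entireLFunction 1 = (((W.mordellWeilRank.factorial : ℝ) * (q : ℝ) * Literature.NumberTheory.EllipticCurves.ModularForms.plusPeriod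 f * W.regulator : ℝ) : ℂ) ∧ PowerSeries.coeff W.mordellWeilRank (Literature.NumberTheory.EllipticCurves.padicLFunction f (Literature.NumberTheory.EllipticCurves.unitRoot W p : ℚ_[p])) * Literature.NumberTheory.EllipticCurves.padicLog p (Literature.NumberTheory.EllipticCurves.cyclotomicGenerator p) ^ W.mordellWeilRank = (q : ℚ_[p]) * (1 - (Literature.NumberTheory.EllipticCurves.unitRoot W p : ℚ_[p])⁻¹) ^ 2 * WeierstrassCurve.padicRegulator D

/-- item stmt-BirchSwinnertonDyer-16799 · aside · rank 9 · open · by planner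
sources: Kato2004Asterisque, Thm 17.4 (p. 273), Thm 18.4 (p. 281), MazurTateTeitelbaum1986Invent, §II.10, arXiv:1910.07404, Cor. 1.10, Summits/BirchSwinnertonDyer/BirchSwinnertonDyer/Cruxes/Consistency/Lines/Sketch.lean (consistency_of_stubs), Summits/BirchSwinnertonDyer/BirchSwinnertonDyer/Theorems/LeadingTermConsistencyCells.lean
[support] GLUE (route-repair unused-crux rrepair-d39b2c31, rev 10): the CONDITIONAL FORM of crux #2
Consistency that its line `Sketch` actually delivers — Kato's divisibility (crux #5
KatoDivisibility, stmt-18082) → no excess rank (crux #4 SqueezeUBR2) → the known rank ≤ 1 slice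
(support RankLeOne, stmt-16219) → Consistency. It is the implication item through which the Kato
crux FEEDS the closes hypothesis Consistency (hierarchical cone: premises KatoDivisibility,
SqueezeUBR2, RankLeOne; head Consistency). `closes` is unchanged (Consistency → PinchPrime →
SqueezeUBR2 → BirchSwinnertonDyer, certified, crux-only) and needs no Kato input at its own level —
PinchPrime's ord_T L_p = rank already contains Kato's inequality, so a Kato hypothesis there would
be decoration; Kato is a SECOND-LAYER input of #2 only. FAITHFUL TO THE TREE: the lead's composition
`consistency_of_stubs (hUB : SqueezeUBR2) (hR1 : RankLeOne) (hK : PAdicOrderKatoSideR2) :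
Consistency` (Cruxes/Consistency/Lines/Sketch.lean v3; bookkeeping landed as
Theorems/LeadingTermConsistencyCells `consistency_of_open_stubs`) plus the stub closures that
consume Kato in corank form (S1b: Theorems/LeadingTermConsistencyStubDeficien -/
@[route_item "route-BirchSwinnertonDyer-LeadingTerm"]
def ConsistencyOfKato : Prop :=
  KatoDivisibility → SqueezeUBR2 → RankLeOne → Consistency

/-- item stmt-BirchSwinnertonDyer-17007 · aside · rank 9 · open · by planner
why it might fail: At fixed admissible p EQUIVALENT (Kim Thm 1.11, IMC known) to Ш(E)[p]=0 (+ Manin/Tamagawa/E(ℚ_p)[p] side conditions avoidable in the ∃p); fails iff some NON-CM E has Ш[p]≠0 at EVERY admissible p (e.g. divisible Ш); no horizontal-in-p theorem beyond r_an≤1; ℚ→ZMod p cast is junk when p∣denominator.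
sources: arXiv:2203.12159, Kurihara2014, MazurTate1987, arXiv:2103.11535, Kato2004, SkinnerUrban2014
[support] (conjecture-grade; rev-6 REPAIR of TamePinch, stmt-BirchSwinnertonDyer-15532,
refuted-misstated 2026-08-16 by
Summit.BirchSwinnertonDyer.BirchSwinnertonDyer.Theorems.LeadingTermTamePinch_refuted: the ∀W form
ranged over the thirteen CM j-invariants and a CM curve over ℚ has no odd prime of surjective mod-p
image — witness y² = x³ − x = 32a2; C′ = the refuter's repaired statement, `¬ W.HasCM →` prepended
to the body verbatim; the witness misses it) the SCHNEIDER-FREE pinch of the intended tame form for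
NON-CM curves (2001 archimedean-tame-consistency Thm A / Kurihara–Kim): every non-CM elliptic E/ℚ
(globally minimal W) has an admissible p (good ordinary ≥ 5, ρ̄_{E,p} surjective — infinitely many
by Serre1972 + density-one ordinary primes) and a square-free product n of r = rank_ℤ E(ℚ) Kolyvagin
primes ℓ (ℓ ∤ Np, ℓ ≡ 1, a_ℓ ≡ ℓ+1 ≡ 2 mod p: Kim's 𝒫₁) whose Kurihara number δ_n = Σ_(a∈(ℤ/n)^×)
[a/n]⁺_f · Π_ℓ ψ_ℓ(a) is non-zero mod p for some surjective discrete logs ψ_ℓ : (ℤ/ℓ)^× → ℤ/p; by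
Kim (arXiv:2203.12159 Thm 1.11, under IMC = theorem at such p: Kato2004 + SkinnerUrban2014 + Wan) ⟺
Ш(E)[p] = 0 at ONE admissible p with Kim's side conditions — known for r_an ≤ 1 (Kolyvagi -/
@[route_item "route-BirchSwinnertonDyer-LeadingTerm"]
def TamePinchR : Prop :=
  ∀ (W : WeierstrassCurve ℚ) [W.IsElliptic] [W.IsGloballyMinimal], ¬ W.HasCM → ∃ (p : ℕ) (_ : Fact p.Prime), 5 ≤ p ∧ Literature.NumberTheory.EllipticCurves.IsOrdinaryAt W p ∧ W.HasSurjectiveModNGaloisRep (p : ℤ) ∧ ∃ (N : ℕ) (_ : NeZero N) (f : CuspForm (CongruenceSubgroup.Gamma0 N) 2), Literature.NumberTheory.EllipticCurves.ModularForms.IsNewformOf W f ∧ ∃ (n : ℕ) (_ : NeZero n), Squarefree n ∧ n.primeFactors.card = W.mordellWeilRank ∧ (∀ ℓ ∈ n.primeFactors, ¬ ℓ ∣ N * p ∧ (ℓ : ZMod p) = 1 ∧ (W.frobeniusTrace ℓ : ZMod p) = 2) ∧ ∃ ψ : (ℓ : ℕ) → (ZMod ℓ)ˣ →* Multiplicative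 (ZMod p), (∀ ℓ ∈ n.primeFactors, Function.Surjective (ψ ℓ)) ∧ (∑ a : (ZMod n)ˣ, (Literature.NumberTheory.EllipticCurves.ratPlusSymbol f (((a : ZMod n).val : ℚ) / n) : ZMod p) * ∏ ℓ ∈ n.primeFactors.attach, Multiplicative.toAdd (ψ ℓ.1 (ZMod.unitsMap (Nat.dvd_of_mem_primeFactors ℓ.2) a))) ≠ 0

-- earlier Assembly (stmt-BirchSwinnertonDyer-15534, replaced 2026-08-16T15:46:34Z -> stmt-BirchSwinnertonDyer-15624): retired by None — Consistency → PinchPrime → SqueezeUBR2 → PeriodRegulatorPos → _root_.BirchSwinnertonDyer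
/-- item stmt-BirchSwinnertonDyer-15624 · assembly · rank 1 · closed · proved by Summit.BirchSwinnertonDyer.BirchSwinnertonDyer.Theorems.leadingTerm_assembly_proof @ 9986499f8233 (prover) · by planner
sources: MazurTateTeitelbaum1986Invent, Kato2004
[assembly] Consistency → PinchPrime → SqueezeUBR2 → BirchSwinnertonDyer (the type of closes;
closable by `fun a b c => closes a b c`). -/
@[route_item "route-BirchSwinnertonDyer-LeadingTerm"]
def Assembly : Prop :=
  Consistency → PinchPrime → SqueezeUBR2 → _root_.BirchSwinnertonDyer

-- `Assembly` holds: proved by `Summit.BirchSwinnertonDyer.BirchSwinnertonDyer.Theorems.leadingTerm_assembly_proof` @ 9986499f8233 (its module imports this route file, so no `_holds` link can be stated here).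

-- records of items no longer active in this route (dropped / restated):
-- earlier TamePinch (stmt-BirchSwinnertonDyer-15532, replaced 2026-08-16T21:55:45Z -> stmt-BirchSwinnertonDyer-17007): refuted by Summit.BirchSwinnertonDyer.BirchSwinnertonDyer.Theorems.LeadingTermTamePinch_refuted @ d92bb8bdeddd — ∀ (W : WeierstrassCurve ℚ) [W.IsElliptic] [W.IsGloballyMinimal], ∃ (p : ℕ) (_ : Fact p.Prime), 5 ≤ p ∧ Literature.NumberTheory.EllipticCurves.IsOrdinaryAt W p ∧ W.HasSurj

/-! D-0027 §2.1 — DECIDING THEOREM (planner-authored via `route open/edit --closes-file`; by planner-rrepair-BirchSwinnertonDyer-LeadingTer-b30d6199-0 2026-08-16T16:28:09Z):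
its hypotheses are this route's items and its conclusion the sub-problem Statement (glue_lint), and it elaborates with this file. -/

@[closes "route-BirchSwinnertonDyer-LeadingTerm"] theorem closes (hC : Consistency) (hP : PinchPrime) (hUB : SqueezeUBR2) :
    _root_.BirchSwinnertonDyer := by
  -- (T1) the Mordell–Weil rank is an isomorphism invariant (AEC III.3.1(b); `VariableChangePoints`)
  have hMW : ∀ (W : WeierstrassCurve ℚ) (C : WeierstrassCurve.VariableChange ℚ),
      (C • W).mordellWeilRank = W.mordellWeilRank := fun W C =>
    @WeierstrassCurve.VariableChange.finrank_point_variableChange ℚ _ W C (Classical.decEq ℚ)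
  -- (T2) the local Euler factor over the fraction field of a DVR is an isomorphism invariant
  have hloc : ∀ (R : Type) [CommRing R] [IsDomain R] [IsDiscreteValuationRing R]
      (K : Type) [Field K] [Algebra R K] [IsFractionRing R K]
      (W : WeierstrassCurve K) [W.IsElliptic] (C : WeierstrassCurve.VariableChange K),
      (C • W).localEulerFactor R = W.localEulerFactor R := by
    intro R _ _ _ K _ _ _ W _ C
    obtain ⟨D, hD⟩ : ∃ D : WeierstrassCurve.VariableChange K,
        (C • W).minimal R = D • W.minimal R :=
      ⟨((C • W).exists_isMinimal R).choose * C * ((W.exists_isMinimal R).choose)⁻¹, by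
        rw [WeierstrassCurve.minimal, WeierstrassCurve.minimal, mul_smul, mul_smul, inv_smul_smul]⟩
    haveI hE : (W.minimal R).IsElliptic := by rw [WeierstrassCurve.minimal]; infer_instance
    have hΔ : (W.minimal R).Δ ≠ 0 := (W.minimal R).isUnit_Δ.ne_zero
    have hgood : ((C • W).minimal R).HasGoodReduction R ↔ (W.minimal R).HasGoodReduction R := by
      rw [WeierstrassCurve.hasGoodReduction_iff, WeierstrassCurve.hasGoodReduction_iff,
        WeierstrassCurve.valuation_Δ_eq_of_isMinimal_of_eq_smul R hD]
      exact and_congr_left' ⟨fun _ => inferInstance, fun _ => inferInstance⟩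
    have hcard : Nat.card (((C • W).minimal R).reduction R).toAffine.Point =
        Nat.card ((W.minimal R).reduction R).toAffine.Point := by
      obtain ⟨E, hE⟩ := WeierstrassCurve.exists_reduction_eq_smul R hD hΔ
      rw [hE]
      exact WeierstrassCurve.natCard_point_smul _ _
    have hpoly : (C • W).localPolynomial R = W.localPolynomial R := by
      classical
      unfold WeierstrassCurve.localPolynomial
      simp only [hgood, hcard,
        WeierstrassCurve.hasSplitMultiplicativeReduction_iff_of_isMinimal_of_eq_smul R hD hΔ,
        WeierstrassCurve.hasMultiplicativeReduction_iff_of_isMinimal_of_eq_smul R hD hΔ]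
    simp only [WeierstrassCurve.localEulerFactor, WeierstrassCurve.localPowerSeries, hpoly]
  -- (T3) hence the entire L-function and the analytic rank are isomorphism invariants
  have hEL : ∀ (W : WeierstrassCurve ℚ) [W.IsElliptic] (C : WeierstrassCurve.VariableChange ℚ),
      (C • W).entireLFunction = W.entireLFunction := by
    intro W _ C
    have hL : (C • W).LFunction = W.LFunction := by
      unfold WeierstrassCurve.LFunction
      congr 1
      funext v
      simp only [WeierstrassCurve.baseChange, ← WeierstrassCurve.map_variableChange]
      exact hloc _ _ _ _
    have hLS : (C • W).LSeries = W.LSeries := by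
      funext s
      simp only [WeierstrassCurve.LSeries, hL]
    have hEC : (C • W).entireContinuations = W.entireContinuations := by
      simp only [WeierstrassCurve.entireContinuations, hLS]
    unfold WeierstrassCurve.entireLFunction
    rw [hEC, hLS]
  -- main argument
  intro W hW
  haveI : W.IsElliptic := hW
  -- (UB) no excess rank
  have hub : W.mordellWeilRank ≤ W.analyticRank := hUB W
  -- pass to a global minimal model and pinch there: PinchPrime supplies the prime `p`, the canonical
  -- cyclotomic height datum `D` at `p` and the newform `f`
  obtain ⟨C, hCmin⟩ := WeierstrassCurve.hasGlobalMinimalModel_rat_holds W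
  haveI : (C • W).IsGloballyMinimal := hCmin
  obtain ⟨p, hp, h5, hord, D, hD, N, hN, f, hf, horder⟩ := hP (C • W)
  haveI : Fact p.Prime := hp
  haveI : NeZero N := hN
  obtain ⟨hreg, hΩ, q, harch, hpad⟩ := hC (C • W) p h5 hord D hD f hf
  -- the coefficient of `T^{r_MW}` is the leading one, hence non-zero
  have hcoeff : PowerSeries.coeff (C • W).mordellWeilRank
      (Literature.NumberTheory.EllipticCurves.padicLFunction f (Literature.NumberTheory.EllipticCurves.unitRoot (C • W) p : ℚ_[p])) ≠ 0 :=
    (PowerSeries.order_eq_nat.mp horder).1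
  -- `log_p γ_cyc ≠ 0` (Iwasawa logarithm kernel = p^ℤ·μ; proof as in Barriers/ExceptionalZero)
  have hlog : Literature.NumberTheory.EllipticCurves.padicLog p (Literature.NumberTheory.EllipticCurves.cyclotomicGenerator p : ℚ_[p]) ≠ 0 := by
    have hpp : p.Prime := Fact.out
    have hp0 : (p : ℚ_[p]) ≠ 0 := by exact_mod_cast hpp.ne_zero
    have h2 : 2 ≤ Literature.NumberTheory.EllipticCurves.cyclotomicGenerator p := by
      have := Nat.one_le_pow (Literature.NumberTheory.EllipticCurves.cyclotomicExponent p) p hpp.pos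
      unfold Literature.NumberTheory.EllipticCurves.cyclotomicGenerator; omega
    have hγ0 : Literature.NumberTheory.EllipticCurves.cyclotomicGenerator p ≠ 0 := by omega
    have hγ : ((Literature.NumberTheory.EllipticCurves.cyclotomicGenerator p : ℕ) : ℚ_[p]) ≠ 0 := by exact_mod_cast hγ0
    have hdvd : ¬ p ∣ Literature.NumberTheory.EllipticCurves.cyclotomicGenerator p := by
      intro h
      have he : Literature.NumberTheory.EllipticCurves.cyclotomicExponent p ≠ 0 := by unfold Literature.NumberTheory.EllipticCurves.cyclotomicExponent; split_ifs <;> omega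
      have h' : p ∣ p ^ Literature.NumberTheory.EllipticCurves.cyclotomicExponent p := dvd_pow_self p he
      have h1 : p ∣ 1 := by
        have := Nat.dvd_sub h h'
        simpa [Literature.NumberTheory.EllipticCurves.cyclotomicGenerator] using this
      exact hpp.one_lt.ne' (Nat.dvd_one.mp h1)
    intro h0
    obtain ⟨n, k, hk, h⟩ := (Literature.NumberTheory.EllipticCurves.padicLog_eq_zero_iff_holds (p := p) hγ).mp h0
    obtain ⟨m, rfl | rfl⟩ := Int.eq_nat_or_neg n
    · rw [zpow_neg, zpow_natCast, mul_pow, inv_pow,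
        mul_inv_eq_one₀ (pow_ne_zero _ (pow_ne_zero _ hp0))] at h
      have h' : Literature.NumberTheory.EllipticCurves.cyclotomicGenerator p ^ k = (p ^ m) ^ k := by exact_mod_cast h
      rcases Nat.eq_zero_or_pos m with rfl | hm
      · rw [pow_zero, one_pow, Nat.pow_eq_one] at h'
        omega
      · have : p ∣ Literature.NumberTheory.EllipticCurves.cyclotomicGenerator p := by
          apply hpp.dvd_of_dvd_pow (n := k)
          rw [h']
          exact dvd_pow (dvd_pow_self p hm.ne') hk.ne'
        exact hdvd this
    · rw [neg_neg, zpow_natCast] at h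
      have h' : (Literature.NumberTheory.EllipticCurves.cyclotomicGenerator p * p ^ m) ^ k = 1 := by exact_mod_cast h
      rw [Nat.pow_eq_one] at h'
      rcases h' with h' | h'
      · have := Nat.eq_one_of_mul_eq_one_right h'
        omega
      · omega
  have hq : q ≠ 0 := by
    rintro rfl
    have h0 : PowerSeries.coeff (C • W).mordellWeilRank
        (Literature.NumberTheory.EllipticCurves.padicLFunction f (Literature.NumberTheory.EllipticCurves.unitRoot (C • W) p : ℚ_[p])) *
        Literature.NumberTheory.EllipticCurves.padicLog p (Literature.NumberTheory.EllipticCurves.cyclotomicGenerator p) ^ (C • W).mordellWeilRank = 0 := by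
      rw [hpad]; push_cast; ring
    exact (mul_ne_zero hcoeff (pow_ne_zero _ hlog)) h0
  -- hence the `r_MW`-th Taylor coefficient of `L(E,s)` at `s = 1` is non-zero (`Ω⁺_f > 0` and
  -- `Reg_∞ > 0` are the well-definedness conjuncts of Consistency)
  have hder : iteratedDeriv W.mordellWeilRank W.entireLFunction 1 ≠ 0 := by
    rw [← hMW W C, ← hEL W C, harch]
    have h1 : (0 : ℝ) < (C • W).mordellWeilRank.factorial := by exact_mod_cast Nat.factorial_pos _
    have hq' : (q : ℝ) ≠ 0 := by exact_mod_cast hq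
    have : ((C • W).mordellWeilRank.factorial : ℝ) * (q : ℝ) * Literature.NumberTheory.EllipticCurves.ModularForms.plusPeriod f * (C • W).regulator ≠ 0 :=
      mul_ne_zero (mul_ne_zero (mul_ne_zero h1.ne' hq') hΩ.ne') hreg.ne'
    exact_mod_cast this
  -- so the analytic rank is at most the Mordell–Weil rank (junk-robust: `analyticRank = 0` is fine)
  have hle : W.analyticRank ≤ W.mordellWeilRank := by
    by_contra hlt
    push Not at hlt
    have han : AnalyticAt ℂ W.entireLFunction 1 := by
      by_contra h
      have : W.analyticRank = 0 := by
        unfold WeierstrassCurve.analyticRank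
        exact analyticOrderNatAt_of_not_analyticAt h
      omega
    have htop : analyticOrderAt W.entireLFunction 1 ≠ ⊤ := by
      intro h
      have : W.analyticRank = 0 := by
        unfold WeierstrassCurve.analyticRank analyticOrderNatAt
        rw [h]; rfl
      omega
    have hcast : ((W.analyticRank : ℕ) : ℕ∞) = analyticOrderAt W.entireLFunction 1 := by
      unfold WeierstrassCurve.analyticRank
      exact Nat.cast_analyticOrderNatAt htop
    have hzero := (natCast_le_analyticOrderAt_iff_iteratedDeriv_eq_zero han).mp hcast.le
      W.mordellWeilRank hlt
    exact hder hzero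
  exact le_antisymm hle hub

end Summit.BirchSwinnertonDyer.BirchSwinnertonDyer.Theses.LeadingTerm
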